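import Literature.Probability.RandomPlanarGeometry.HexSAWSurfaceWallRenewalFourthExact
import Literature.Probability.RandomPlanarGeometry.HexSAWSurfaceSixthOrderUpper
import Literature.Probability.RandomPlanarGeometry.HexSAWSurfaceWallRenewalVisitExcess
import Literature.Probability.RandomPlanarGeometry.HexSAWSurfaceWallRenewalBlocks
import HarnessLib

/-!
# The renewal mean to FIFTH order, exactly: `m(y) = 1 + 2/y² + 3/y³ + 11/y⁴ + 30/y⁵ + o(y⁻⁵)`; the SURFACE CONTACT DENSITY to fifth order:
# `½ − ρ(log y) = 1/y² + 3/(2y³) + 3/y⁴ + 15/(2y⁵) + o(y⁻⁵)` (edition 2, §6–§9); the order-five analytic census: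
# `N₆₁ = 6` (the irreducible positive wall bridges of length twelve are the six positive one-visit seeds and the hooked block —
# `#(ipwb 12) = 7`, `Λ₁₂(y) = 6y + y²`), `N₇₂ = 3` (`Λ₁₄(y) = N₇₁·y + 3y²`), and every irreducible positive wall bridge of length
# `n ≥ 16` has at most `n/2 − 6` surface visits (`N₈₃ = N₉₄ = N₁₀,₅ = N₁₁,₆ = 0`)

Topic `Literature/Probability/RandomPlanarGeometry` (lane «pcv-sawmu», a-p6 g18, car «FIFTH-EXACT-MEAN»; parents: the same seat's
«FOURTH-EXACT-MEAN» `HexSAWSurfaceWallRenewalFourthExact.lean` (`eq_qw_of_mem_ipwb_twelve_of_visits_eq_two`, `card_ipwb_twelve_eq : N₆ = N₆₁ + 1`,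
`IPWB_twelve_eq : Λ₁₂ = N₆₁ y + y²`, `visits_le_two_of_mem_ipwb_fourteen`, `two_mul_visits_add_ten_le`, `hasSum_excess_tail_ten`,
`tendsto_div_wallRate_sq`, `tendsto_sq_mul_one_sub_div_wallRate_sq`, and through it the a-idea-1 pool «FLOOR-SEVENTEEN» (`Twelve.qw`),
«TEN-THREE» (`mem_ipwb_of_facts`, `pwbLaw_five_eq`), «THIRD-EXACT» and `HexSAWSurfaceFourthOrderExact.wallRate_sq_fourth_mem_Icc`);
the a-idea-1 g32 exhibit module «BLOCKS» `HexSAWSurfaceWallRenewalBlocks.lean` (the six positive one-visit twelves `TwelveOne.W : Fin 6 → _`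
with `TwelveOne.W_mem_ipwb`, `TwelveOne.visits_W`, `TwelveOne.W_injective`, and the three hooked two-visit fourteens `FourteenTwo.W : Fin 3 → _`
with `FourteenTwo.W_mem_ipwb`, `FourteenTwo.visits_W`, `FourteenTwo.W_injective`);
and the same lineage's SIXTH-ORDER UPPER WINDOW `HexSAWSurfaceSixthOrderUpper.wallRate_sq_le_sixth`
(`β(y)² ≤ y + 1/y + 1/y² + 2/y³ + 4/y⁴ + 6/y⁵ + 57395700/y⁶`, `y ≥ 36`) — the FIFTH-order window is too coarse at this order
(its room `6.4·10⁻³⁰` at `y = 10⁶` exceeds the class signal `10⁻³⁰`; the sixth-order window leaves `8.4·10⁻³⁵`).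
Edition 2 also imports the pool car «VISIT-EXCESS» `HexSAWSurfaceWallRenewalVisitExcess.lean` (`V = pwbVisitMean`, `hasSum_pwbVisitMean_sub_one`,
`IPWBV_sub_IPWB_eq_sum`, `IPWBV_sub_IPWB_le_mul`, `pwbMean_sub_pwbVisitMean_eq : m − V = 2m(½ − ρ⁺(log y))`; through it «NO-KINK»'s renewal–reward
identity `ρ^±(t) = V(eᵗ)/(2m(eᵗ))`, `mul_deriv_wallRate_div_eq`, and «EXCESS-LIMIT»'s `tendsto_sq_mul_pwbMean_sub_one : y²(m − 1) → 2`) and the TREE's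
`HexSAWSurfaceWallDensity.lean` / `HexSAWSurfaceWallDensityCoefficient.lean` (`ρ^±`, `e^{2t}(½ − ρ⁺(t)) → 1`); additional sources for §6–§9: G. Giacomin,
LNM 2025 (2011), Chapter 2, (2.9)–(2.11); E. J. Janse van Rensburg, S. G. Whittington, J. Phys. A 46 (2013), Section 3.1.

Sources (primary; identifiers verbatim, no quotation marks).  N. Madras, G. Slade, *The Self-Avoiding Walk*, Birkhäuser 1993: Section 1.2,
(1.2.3) and Definition 1.2.4; Section 4.2, Definition 4.2.1, (4.2.2)–(4.2.5) and Theorem 4.2.2 (pp. 91–92), remark before (4.2.21) (p. 94).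
H. Kesten, J. Math. Phys. 4 (1963) 960, Section 4.  W. Feller, *An Introduction to Probability Theory and Its Applications* I (3rd ed. 1968),
XIII.3.  H. Duminil-Copin, A. Hammond, CMP 324 (2013), Section 2.2.  I. G. Enting, I. Jensen, LNP 775 (2009), Section 7.4.2, Fig. 7.10.
E. J. Janse van Rensburg, OUP 2000, Section 3.3.2, Lemma 3.20.  N. R. Beaton, M. Bousquet-Mélou, J. de Gier, H. Duminil-Copin, A. J. Guttmann,
CMP 326 (2014) = arXiv:1109.0358v5, Section 3.1, Proposition 5 (p. 9) and p. 10.  H. Duminil-Copin, S. Smirnov, Ann. Math. 175 (2012), Theorem 1.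

## What is proved (namespace `…SAW.HexBW.Wall`; block lengths symbolic)

* §1 EXHIBIT PACKAGING (the exhibits themselves are «BLOCKS»'): `image_twelveOne_subset_ipwb`, `card_image_twelveOne`, `sum_image_twelveOne`
  (the six positive one-visit twelves contribute `6y`), `image_fourteenTwo_subset_ipwb`, `card_image_fourteenTwo`, `sum_image_fourteenTwo` (the three
  hooked two-visit fourteens contribute `3y²`), `three_le_card_twoVisit_ipwb_fourteen`.
* §2 (private) the ROOM LEMMA at `y = 10⁶` at order five (sixth-order window; degree-7 Taylor bound, `norm_num` on ≤ 45-digit rationals).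
* §3 ★★★ THE ORDER-FIVE CENSUS.  `exists_eq_twelveOne_W_of_mem_ipwb_twelve_of_visits_eq_one` (a one-visit irreducible block of length twelve is one
  of the six seeds — the SET classification as a corollary of count + exhibits), ★★★ `card_oneVisit_ipwb_twelve_eq_six` (**`N₆₁ = 6`**, door D2
  of the lane), ★★ `card_ipwb_twelve_eq_seven`, `exists_eq_fourteenTwo_W_of_mem_ipwb_fourteen_of_visits_eq_two`, `twoVisit_ipwb_fourteen_eq_image`, ★★ `card_twoVisit_ipwb_fourteen_eq_three`
  (**`N₇₂ = 3`**); `visits_le_two_of_mem_ipwb_sixteen` (N₈₃ = 0), `visits_le_three_of_mem_ipwb_eighteen` (N₉₄ = 0), `visits_le_four_of_mem_ipwb_twenty`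
  (N₁₀,₅ = 0), `visits_le_five_of_mem_ipwb_twentytwo` (N₁₁,₆ = 0); ★★ `two_mul_visits_add_twelve_le (hn : 16 ≤ n) : 2·visits + 12 ≤ n`.
* §4 ★★ `IPWB_twelve_eq_six : Λ₁₂(y) = 6y + y²`, `pwbLaw_six_eq_six : f₆ = (6y + y²)/β¹²`, `IPWB_fourteen_eq : Λ₁₄(y) = N₇₁·y + 3y²`, `pwbLaw_seven_eq`,
  `pwbLaw_le_card_div_pow_six (s ≥ 8)`, `head_seven_mul_pwbLaw_le`, `six_mul_pwbLaw_seven_le`, `hasSum_excess_tail_twelve`,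
  `excess_tail_twelve_le (48 ≤ y) : … ≤ 24 μ²⁶/(y⁵√y)`, ★★ `pow_five_mul_pwbMean_sub_le`, `eighteen_mul_le_pow_five_mul`, the window.
* §5 ★★★ **`tendsto_pow_five_mul_pwbMean_sub : y⁵ (m(y) − 1 − 2y/β⁶ − 3y/β⁸ − 12y/β¹⁰ − (30y + 5y²)/β¹²) → 18`** (`18 = 6·N₇₂`),
  `tendsto_cube_mul_one_sub_div_sub : y³(1 − y/β²) − y → 1` (from the tree's fourth-order window), and
  ★★★ **`tendsto_pow_five_mul_pwbMean_sub_four_terms : y⁵ (m(y) − 1 − 2/y² − 3/y³ − 11/y⁴) → 30`**, i.e.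
  **`m(y) = 1 + 2/y² + 3/y³ + 11/y⁴ + 30/y⁵ + o(y⁻⁵)`** (`30 = 6·N₆₁ + 7·N₇₂ − 27`), `isEquivalent_pwbMean_sub_four_terms`.

## What is proved, part II (edition 2, §6–§9 — formerly the separate draft «DENSITY-FIFTH-ORDER»): the visit mean `V` and the CONTACT DENSITY to fifth order

* §6 THE VISIT EXCESS POLYNOMIALS: `IPWBV_sub_IPWB_twelve : Λ^v₁₂ − Λ₁₂ = y²` (the hooked block), `IPWBV_sub_IPWB_fourteen : Λ^v₁₄ − Λ₁₄ = 3y²`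
  (the three hooked fourteens), `IPWBV_sub_IPWB_le_of_sixteen_le : Λ^v_n − Λ_n ≤ (n/2 − 7)·#(ipwb n)·y^{n/2 − 6}` (`n ≥ 16`, `y ≥ 1`),
  `visitExcess_term_le_nine_pow : (Λ^v − Λ)_{2s}/β^{2s} ≤ (s − 7)·9^s/y⁶` (`8 ≤ s`).
* §7 ★★ `hasSum_visitExcess_sixteen`, `pwbVisitMean_sub_one_ge : y²/β¹² + 3y²/β¹⁴ ≤ V − 1` (`y > μ⁴`), ★★ `pwbVisitMean_sub_one_le_five (48 ≤ y) :
  V − 1 ≤ y²/β¹² + 3y²/β¹⁴ + 136802479338/y⁶ + 12 μ²⁶/(y⁵√y)`.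
* §8 ★★★ **`tendsto_pow_four_mul_pwbVisitMean_sub_one : y⁴(V(y) − 1) → 1`** (= N₆₂: the hooked twelve carries the whole fourth order of the visit
  excess; «VISIT-EXCESS» had `y²(V − 1) → 0`), ★★★ **`tendsto_pow_five_mul_pwbVisitMean_sub : y⁵(V(y) − 1 − y²/β¹²) → 3`** (= N₇₂),
  `tendsto_pow_five_mul_pwbVisitMean_sub_one_sub : y⁵(V − 1 − 1/y⁴) → 3`, i.e. **`V(y) = 1 + 1/y⁴ + 3/y⁵ + o(y⁻⁵)`**.
* §9 ★★★ THE CONTACT DENSITY TO FIFTH ORDER (`ρ = V/(2m)`): **`tendsto_pow_four_mul_density_deficit : y⁴(½ − ρ⁺(log y) − 1/y² − 3/(2y³)) → 3`**,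
  **`tendsto_pow_five_mul_density_deficit : y⁵(½ − ρ⁺(log y) − 1/y² − 3/(2y³) − 3/y⁴) → 15/2`**, the `t`-forms
  `tendsto_exp_four_mul_deficit : e^{4t}(½ − ρ⁺(t) − e^{−2t} − (3/2)e^{−3t}) → 3`, `tendsto_exp_five_mul_deficit : e^{5t}(… − 3e^{−4t}) → 15/2`,
  the same for `ρ⁻` (no kink), and for the logarithmic derivative `y β'(y)/β(y)`:
  **`½ − ρ(log y) = 1/y² + 3/(2y³) + 3/y⁴ + 15/(2y⁵) + o(y⁻⁵)`** — integer/half-integer coefficients `1, 3/2, 3, 15/2` from the census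
  `(m − V)/(2m)` with `m = 1 + 2u² + 3u³ + 11u⁴ + 30u⁵`, `V = 1 + u⁴ + 3u⁵`.

NOT claimed: the sixth order (needs the order-six census, i.e. a seventh-order upper window for `β²`); anything at `y ≤ μ⁴`; the value of `ρ` at
or near the adsorption threshold; numerics.  NEW IN WRITING (modest): the fourth and fifth coefficients of the strong-adsorption expansion of the
surface contact density (and of the mean visit number per renewal block) of the adsorbing honeycomb walk; print has the renewal structure
(M–S §4.2, Kesten §4), the renewal–reward identity (Giacomin Ch. 2) and first-order adsorption asymptotics (BBdGDCG p. 10; JvR–W 2013 §3.1).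

NOT claimed: `N₇₁` (census `15`), `N₈₂` (census `11`), `N₉₃` (census `1`) — the order-six classes, which by the same bookkeeping carry the
lane's conjecture `a₅ = 6` (`a₅ = Σ_s N_{s,s−6} − 21`); nothing for `y ≤ μ⁴`; no statement about BBdGDCG's `μ(y)` beyond the parents.
NEW IN WRITING (modest): the order-five census, the fifth-order renewal mean of the positive-wall-bridge renewal structure, and (edition 2) the
fourth and fifth coefficients of the strong-adsorption expansion of the surface contact density and of the mean visit number per renewal block of
the adsorbing honeycomb walk are computed here; print has the renewal structure (M–S §4.2, Kesten §4), the renewal–reward identity (Giacomin Ch. 2)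
and first-order adsorption asymptotics only (BBdGDCG p. 10; JvR–W 2013 §3.1).
-/

namespace Literature.Probability.RandomPlanarGeometry.SAW.HexBW.Wall

open Finset Filter Function
open Literature.Probability.LatticeModels
open _root_.Topology Asymptotics

variable {y : ℝ} {n : ℕ} {ω : ℕ → Site 2}

/-! ### §0  Private helpers -/

/-- `μ² = 2 + √2`. [cite: DuminilCopinSmirnov2012, Theorem 1] -/
private theorem mu_sq_fv : hexConnectiveConstant ^ 2 = 2 + Real.sqrt 2 := by
  rw [hexConnectiveConstant_eq_inv, inv_pow]; exact inv_eq_of_mul_eq_one_right hexCriticalFugacity_sq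

/-- `4 ≤ μ⁴`. [cite: DuminilCopinSmirnov2012, Theorem 1] -/
private theorem four_le_mu_four_fv : 4 ≤ hexConnectiveConstant ^ 4 := by
  have h2 : 0 ≤ Real.sqrt 2 := Real.sqrt_nonneg 2
  calc (4 : ℝ) ≤ (2 + Real.sqrt 2) ^ 2 := by nlinarith
    _ = hexConnectiveConstant ^ 4 := by rw [← mu_sq_fv]; ring

/-- `μ⁴ < 12`. [cite: DuminilCopinSmirnov2012, Theorem 1] -/
private theorem mu_four_lt_twelve_fv : hexConnectiveConstant ^ 4 < 12 := by
  have hup : Real.sqrt 2 ≤ 1.41422 := by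
    rw [show (1.41422 : ℝ) = Real.sqrt (1.41422 ^ 2) by rw [Real.sqrt_sq (by norm_num)]]
    exact Real.sqrt_le_sqrt (by norm_num)
  have h2 : 0 ≤ Real.sqrt 2 := Real.sqrt_nonneg 2
  calc hexConnectiveConstant ^ 4 = (hexConnectiveConstant ^ 2) ^ 2 := by ring
    _ = (2 + Real.sqrt 2) ^ 2 := by rw [mu_sq_fv]
    _ ≤ (2 + 1.41422) ^ 2 := by gcongr
    _ < 12 := by norm_num

/-- `μ⁴ < 10⁶`. [cite: DuminilCopinSmirnov2012, Theorem 1] -/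
private theorem mu_four_lt_Y_fv : hexConnectiveConstant ^ 4 < 1000000 := mu_four_lt_twelve_fv.trans (by norm_num)

/-- `y ≤ β(y)²`. [cite: BeatonBousquetMelouDeGierDuminilCopinGuttmann2014, Section 3.1, Proposition 5 (arXiv v5 p. 9)] -/
private theorem le_sq_wallRate_fv (hy : 0 < y) : y ≤ wallRate y ^ 2 := by
  have h := pow_le_pow_left₀ (Real.sqrt_nonneg y) (sqrt_le_wallRate hy) 2
  rwa [Real.sq_sqrt hy.le] at h

/-- `y^k ≤ β(y)^{2k}`. [cite: BeatonBousquetMelouDeGierDuminilCopinGuttmann2014, Section 3.1, Proposition 5 (arXiv v5 p. 9)] -/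
private theorem pow_le_wallRate_pow_fv (hy : 0 < y) (k : ℕ) : y ^ k ≤ wallRate y ^ (2 * k) := by
  rw [pow_mul]; exact pow_le_pow_left₀ hy.le (le_sq_wallRate_fv hy) k

/-- `f_s(y) = Λ_{2s}(y)/(β(y)²)^s`. [cite: MadrasSlade1993, Section 4.2, (4.2.2) (p. 91)] -/
private theorem pwbLaw_eq_fv (y : ℝ) (s : ℕ) : pwbLaw y s = IPWB (2 * s) y / (wallRate y ^ 2) ^ s := by
  rw [pwbLaw, pow_mul]

/-- A finite SUBSET of the irreducible blocks bounds `f_s` from below by the sum of its monomials.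
[cite: MadrasSlade1993, Section 4.2, (4.2.2) (p. 91)] -/
private theorem subset_div_le_pwbLaw_fv (hy : 0 ≤ y) {s n : ℕ} (hn : 2 * s = n) {S : Finset (ℕ → Site 2)} (hS : S ⊆ ipwb n) :
    (∑ ω ∈ S, y ^ visits n ω) / (wallRate y ^ 2) ^ s ≤ pwbLaw y s := by
  subst hn
  rw [pwbLaw_eq_fv]
  exact div_le_div_of_nonneg_right (Finset.sum_le_sum_of_subset_of_nonneg hS fun _ _ _ => pow_nonneg hy _)
    (pow_nonneg (sq_nonneg _) _)

/-- A single irreducible block bounds `f_s` from below. [cite: MadrasSlade1993, Section 4.2, (4.2.2) (p. 91)] -/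
private theorem single_div_le_pwbLaw_fv (hy : 0 ≤ y) {s n : ℕ} (hn : 2 * s = n) (hω : ω ∈ ipwb n) :
    y ^ visits n ω / (wallRate y ^ 2) ^ s ≤ pwbLaw y s := by
  have h := subset_div_le_pwbLaw_fv hy hn (Finset.singleton_subset_iff.2 hω)
  rwa [Finset.sum_singleton] at h

/-- Kesten partial sums: `Σ_{s ∈ S} f_s(y) ≤ 1` for `y > μ⁴`. [cite: MadrasSlade1993, Section 4.2, (4.2.4) and Theorem 4.2.2 (pp. 91–92)] [cite: Kesten1963SAW, Section 4] -/
private theorem sum_pwbLaw_le_one_fv (hy : hexConnectiveConstant ^ 4 < y) (S : Finset ℕ) : ∑ s ∈ S, pwbLaw y s ≤ 1 := by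
  have hy0 : 0 ≤ y := by have := four_le_mu_four_fv; linarith
  exact sum_le_hasSum S (fun s _ => pwbLaw_nonneg hy0 s) (hasSum_pwbLaw hy)

/-- Kesten partial sum on `{1, 3, 4, 5, 6, 7}`. [cite: MadrasSlade1993, Section 4.2, (4.2.4) (p. 91)] [cite: Kesten1963SAW, Section 4] -/
private theorem kesten_six_fv (hy : hexConnectiveConstant ^ 4 < y) :
    pwbLaw y 1 + (pwbLaw y 3 + (pwbLaw y 4 + (pwbLaw y 5 + (pwbLaw y 6 + pwbLaw y 7)))) ≤ 1 := by
  have h := sum_pwbLaw_le_one_fv hy {1, 3, 4, 5, 6, 7}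
  have h1 : (1 : ℕ) ∉ ({3, 4, 5, 6, 7} : Finset ℕ) := by simp only [Finset.mem_insert, Finset.mem_singleton]; omega
  have h3 : (3 : ℕ) ∉ ({4, 5, 6, 7} : Finset ℕ) := by simp only [Finset.mem_insert, Finset.mem_singleton]; omega
  have h4 : (4 : ℕ) ∉ ({5, 6, 7} : Finset ℕ) := by simp only [Finset.mem_insert, Finset.mem_singleton]; omega
  have h5 : (5 : ℕ) ∉ ({6, 7} : Finset ℕ) := by simp only [Finset.mem_insert, Finset.mem_singleton]; omega
  have h6 : (6 : ℕ) ∉ ({7} : Finset ℕ) := by simp only [Finset.mem_singleton]; omega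
  rwa [Finset.sum_insert h1, Finset.sum_insert h3, Finset.sum_insert h4, Finset.sum_insert h5, Finset.sum_insert h6,
    Finset.sum_singleton] at h

/-- Kesten partial sum on `{1, 3, 4, 5, 6, 7, s}`. [cite: MadrasSlade1993, Section 4.2, (4.2.4) (p. 91)] [cite: Kesten1963SAW, Section 4] -/
private theorem kesten_seven_fv (hy : hexConnectiveConstant ^ 4 < y) {s : ℕ} (hs1 : s ≠ 1) (hs3 : s ≠ 3) (hs4 : s ≠ 4) (hs5 : s ≠ 5)
    (hs6 : s ≠ 6) (hs7 : s ≠ 7) :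
    pwbLaw y 1 + (pwbLaw y 3 + (pwbLaw y 4 + (pwbLaw y 5 + (pwbLaw y 6 + (pwbLaw y 7 + pwbLaw y s))))) ≤ 1 := by
  have h := sum_pwbLaw_le_one_fv hy {1, 3, 4, 5, 6, 7, s}
  have h1 : (1 : ℕ) ∉ ({3, 4, 5, 6, 7, s} : Finset ℕ) := by simp only [Finset.mem_insert, Finset.mem_singleton]; omega
  have h3 : (3 : ℕ) ∉ ({4, 5, 6, 7, s} : Finset ℕ) := by simp only [Finset.mem_insert, Finset.mem_singleton]; omega
  have h4 : (4 : ℕ) ∉ ({5, 6, 7, s} : Finset ℕ) := by simp only [Finset.mem_insert, Finset.mem_singleton]; omega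
  have h5 : (5 : ℕ) ∉ ({6, 7, s} : Finset ℕ) := by simp only [Finset.mem_insert, Finset.mem_singleton]; omega
  have h6 : (6 : ℕ) ∉ ({7, s} : Finset ℕ) := by simp only [Finset.mem_insert, Finset.mem_singleton]; omega
  have h7 : (7 : ℕ) ∉ ({s} : Finset ℕ) := by simp only [Finset.mem_singleton]; omega
  rwa [Finset.sum_insert h1, Finset.sum_insert h3, Finset.sum_insert h4, Finset.sum_insert h5, Finset.sum_insert h6,
    Finset.sum_insert h7, Finset.sum_singleton] at h

/-- Every irreducible positive wall bridge visits the surface at least once (its endpoint). [cite: MadrasSlade1993, Section 4.2, Definition 4.2.1 (p. 91)] -/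
private theorem one_le_visits_fv (hω : ω ∈ ipwb n) : 1 ≤ visits n ω := by
  classical
  obtain ⟨hp, hn1, -⟩ := mem_ipwb.1 hω
  obtain ⟨hw, -⟩ := mem_pwb.1 hp
  obtain ⟨ha, -⟩ := mem_wbr.1 hw
  obtain ⟨-, hn2, hYn⟩ := mem_archs.1 ha
  obtain ⟨k, rfl⟩ : ∃ k, n = k + 1 := ⟨n - 1, by omega⟩
  rw [visits_succ, if_pos ⟨hn2, hYn⟩]
  omega

/-- The length of an irreducible positive wall bridge is even (it is an arch). [cite: MadrasSlade1993, Section 1.2, Definition 1.2.4] -/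
private theorem even_len_fv (hω : ω ∈ ipwb n) : n % 2 = 0 := by
  obtain ⟨hp, -, -⟩ := mem_ipwb.1 hω
  obtain ⟨hw, -⟩ := mem_pwb.1 hp
  obtain ⟨ha, -⟩ := mem_wbr.1 hw
  exact (mem_archs.1 ha).2.1

/-- `f₁(y) ≥ y/β²` (the atom). [cite: MadrasSlade1993, Section 4.2, (4.2.2) (p. 91)] -/
private theorem div_sq_wallRate_le_pwbLaw_one_fv (hy : 0 ≤ y) : y / wallRate y ^ 2 ≤ pwbLaw y 1 := by
  obtain ⟨m, hm⟩ : ∃ m : ℕ, m = 2 * 1 := ⟨_, rfl⟩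
  have h := straightWalk_mem_pwb 1
  rw [← hm] at h
  have hmem : Zd.straightWalk 2 m ∈ ipwb m := by
    rw [mem_ipwb]
    refine ⟨h.1, by omega, fun k hk1 hk2 hr => ?_⟩
    have hk : k % 2 = 0 := hr.2.1
    omega
  have h1 := single_div_le_pwbLaw_fv (s := 1) (n := m) hy (by omega) hmem
  rw [h.2, pow_one, pow_one] at h1
  exact h1

/-! ### §1  The exhibits (from «BLOCKS», a-idea-1 g32): the six positive one-visit twelves `TwelveOne.W : Fin 6 → _` (= the tree's
`Twelve.W 0…5`), the three hooked two-visit fourteens `FourteenTwo.W : Fin 3 → _` (the hook `(0,0)…(4,−2)` of `Twelve.qw` completed three ways);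
here only their finite-set packaging -/

open Classical in
/-- The six positive twelves as a finite subset of `ipwb 12` (symbolic length). [cite: MadrasSlade1993, Section 4.2, Definition 4.2.1, (4.2.2)] -/
theorem image_twelveOne_subset_ipwb {m : ℕ} (hm : m = 12) : Finset.univ.image TwelveOne.W ⊆ ipwb m := by
  intro ω hω
  obtain ⟨i, -, rfl⟩ := Finset.mem_image.1 hω
  exact TwelveOne.W_mem_ipwb hm i

open Classical in
/-- `#(TwelveOne.W '' univ) = 6`. [cite: EntingJensen2009, Section 7.4.2, Fig. 7.10] -/
theorem card_image_twelveOne : #(Finset.univ.image TwelveOne.W) = 6 := by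
  rw [Finset.card_image_of_injective _ TwelveOne.W_injective]; simp

open Classical in
/-- The visit monomials of the six positive twelves sum to `6y` (symbolic length). [cite: BeatonBousquetMelouDeGierDuminilCopinGuttmann2014, Section 3.1 (arXiv v5 p. 8)] -/
theorem sum_image_twelveOne {m : ℕ} (hm : m = 12) (y : ℝ) : ∑ ω ∈ Finset.univ.image TwelveOne.W, y ^ visits m ω = 6 * y := by
  rw [Finset.sum_image fun i _ j _ h => TwelveOne.W_injective h]
  have hv : ∀ i : Fin 6, visits m (TwelveOne.W i) = 1 := by rw [hm]; exact TwelveOne.visits_W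
  rw [Finset.sum_congr rfl fun i _ => by rw [hv i, pow_one], Finset.sum_const, Finset.card_univ, Fintype.card_fin, nsmul_eq_mul]
  norm_num

open Classical in
/-- The three hooked fourteens as a finite subset of `ipwb 14` (symbolic length). [cite: MadrasSlade1993, Section 4.2, Definition 4.2.1, (4.2.2)] -/
theorem image_fourteenTwo_subset_ipwb {m : ℕ} (hm : m = 14) : Finset.univ.image FourteenTwo.W ⊆ ipwb m := by
  intro ω hω
  obtain ⟨i, -, rfl⟩ := Finset.mem_image.1 hω
  exact FourteenTwo.W_mem_ipwb hm i

open Classical in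
/-- `#(FourteenTwo.W '' univ) = 3`. [cite: EntingJensen2009, Section 7.4.2, Fig. 7.10] -/
theorem card_image_fourteenTwo : #(Finset.univ.image FourteenTwo.W) = 3 := by
  rw [Finset.card_image_of_injective _ FourteenTwo.W_injective]; simp

open Classical in
/-- The visit monomials of the three hooked fourteens sum to `3y²` (symbolic length). [cite: BeatonBousquetMelouDeGierDuminilCopinGuttmann2014, Section 3.1 (arXiv v5 p. 8)] -/
theorem sum_image_fourteenTwo {m : ℕ} (hm : m = 14) (y : ℝ) : ∑ ω ∈ Finset.univ.image FourteenTwo.W, y ^ visits m ω = 3 * y ^ 2 := by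
  rw [Finset.sum_image fun i _ j _ h => FourteenTwo.W_injective h]
  have hv : ∀ i : Fin 3, visits m (FourteenTwo.W i) = 2 := by rw [hm]; exact FourteenTwo.visits_W
  rw [Finset.sum_congr rfl fun i _ => by rw [hv i], Finset.sum_const, Finset.card_univ, Fintype.card_fin, nsmul_eq_mul]
  norm_num

open Classical in
/-- ★ **`N₇₂ ≥ 3`**: at least three irreducible positive wall bridges of length fourteen have two surface visits (symbolic length).
[cite: MadrasSlade1993, Section 4.2, Definition 4.2.1, (4.2.2)] [cite: JansevanRensburg2000, Section 3.3.2, Lemma 3.20] -/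
theorem three_le_card_twoVisit_ipwb_fourteen {m : ℕ} (hm : m = 14) : 3 ≤ #((ipwb m).filter fun ω => visits m ω = 2) := by
  have hsub : Finset.univ.image FourteenTwo.W ⊆ (ipwb m).filter fun ω => visits m ω = 2 := by
    intro w hw
    rw [Finset.mem_filter]
    refine ⟨image_fourteenTwo_subset_ipwb hm hw, ?_⟩
    obtain ⟨i, -, rfl⟩ := Finset.mem_image.1 hw
    rw [hm]; exact FourteenTwo.visits_W i
  exact card_image_fourteenTwo ▸ Finset.card_le_card hsub

/-! ### §2  The room left by the blocks through order `y⁻⁵` at `y = 10⁶` is below `9·10⁻³¹` (sixth-order upper window) -/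

/-- **Room lemma (order five).**  At `y = 10⁶`: if `y/β² + (y/β⁶ + (y/β⁸ + (3y/β¹⁰ + ((6y + y²)/β¹² + (3y²/β¹⁴ + x))))) ≤ 1` then
`x < 9·10⁻³¹` — from `y ≤ β²` and the sixth-order upper window `β² ≤ y + 1/y + 1/y² + 2/y³ + 4/y⁴ + 6/y⁵ + 57395700/y⁶`: with `B = β²`
and `d = B − y ∈ [0, δ]`, `δ = 10000010000020000040000633957/10³⁴`, the polynomial `B⁷ − yB⁶ − yB⁴ − yB³ − 3yB² − (6y + y²)B − 3y²` has
positive Taylor coefficients in `d` at `y`, so it is at most its value at `d = δ`, `≈ 8.4·10⁷ < 9·10⁻³¹ · y⁷ = 9·10¹¹`.  (The fifth-order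
window would leave `≈ 6.4·10¹²` — too much; exactly, the known blocks leave `(a₅ + 21)/y⁶ + O(y⁻⁷)`.)
[cite: MadrasSlade1993, Section 4.2, (4.2.4) (p. 91)] [cite: BeatonBousquetMelouDeGierDuminilCopinGuttmann2014, Section 3.1, Proposition 5] -/
private theorem no_room5_fv {x : ℝ} (hx : (9 / 10 ^ 31 : ℝ) ≤ x)
    (h : 1000000 / wallRate 1000000 ^ 2 + (1000000 / wallRate 1000000 ^ 6 + (1000000 / wallRate 1000000 ^ 8 +
      (3 * 1000000 / wallRate 1000000 ^ 10 + ((6 * 1000000 + 1000000 ^ 2) / wallRate 1000000 ^ 12 +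
        (3 * 1000000 ^ 2 / wallRate 1000000 ^ 14 + x))))) ≤ 1) :
    False := by
  have e6 : wallRate 1000000 ^ 6 = (wallRate 1000000 ^ 2) ^ 3 := by rw [← pow_mul]
  have e8 : wallRate 1000000 ^ 8 = (wallRate 1000000 ^ 2) ^ 4 := by rw [← pow_mul]
  have e10 : wallRate 1000000 ^ 10 = (wallRate 1000000 ^ 2) ^ 5 := by rw [← pow_mul]
  have e12 : wallRate 1000000 ^ 12 = (wallRate 1000000 ^ 2) ^ 6 := by rw [← pow_mul]
  have e14 : wallRate 1000000 ^ 14 = (wallRate 1000000 ^ 2) ^ 7 := by rw [← pow_mul]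
  rw [e6, e8, e10, e12, e14] at h
  set B := wallRate 1000000 ^ 2 with hB
  have hlo : (1000000 : ℝ) ≤ B := le_sq_wallRate_fv (by norm_num)
  have hhi : B ≤ 1000000 + 1 / 1000000 + 1 / 1000000 ^ 2 + 2 / 1000000 ^ 3 + 4 / 1000000 ^ 4 + 6 / 1000000 ^ 5 +
      57395700 / 1000000 ^ 6 := wallRate_sq_le_sixth (by norm_num)
  have hB0 : 0 < B := by linarith
  have hx0 : 0 ≤ x := le_trans (by norm_num) hx
  have key : 1000000 * B ^ 6 + 1000000 * B ^ 4 + 1000000 * B ^ 3 + 3 * 1000000 * B ^ 2 + (6 * 1000000 + 1000000 ^ 2) * B +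
      3 * 1000000 ^ 2 + x * B ^ 7 ≤ B ^ 7 := by
    have e : 1000000 / B + (1000000 / B ^ 3 + (1000000 / B ^ 4 + (3 * 1000000 / B ^ 5 + ((6 * 1000000 + 1000000 ^ 2) / B ^ 6 +
        (3 * 1000000 ^ 2 / B ^ 7 + x))))) =
        (1000000 * B ^ 6 + 1000000 * B ^ 4 + 1000000 * B ^ 3 + 3 * 1000000 * B ^ 2 + (6 * 1000000 + 1000000 ^ 2) * B +
          3 * 1000000 ^ 2 + x * B ^ 7) / B ^ 7 := by
      field_simp
      ring
    rw [e, div_le_one (pow_pos hB0 7)] at h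
    exact h
  -- Taylor expansion at `y = 10⁶` in `d = B − 10⁶ ∈ [0, δ]`
  set d := B - 1000000 with hd
  have hd0 : 0 ≤ d := by rw [hd]; linarith
  have hdδ : d ≤ 10000010000020000040000633957 / 10 ^ 34 := by
    have hnum : (1000000 : ℝ) + 1 / 1000000 + 1 / 1000000 ^ 2 + 2 / 1000000 ^ 3 + 4 / 1000000 ^ 4 + 6 / 1000000 ^ 5 +
        57395700 / 1000000 ^ 6 ≤ 1000000 + 10000010000020000040000633957 / 10 ^ 34 := by norm_num
    rw [hd]; linarith
  have hBd : B = 1000000 + d := by rw [hd]; ring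
  have eP : B ^ 7 - (1000000 * B ^ 6 + 1000000 * B ^ 4 + 1000000 * B ^ 3 + 3 * 1000000 * B ^ 2 + (6 * 1000000 + 1000000 ^ 2) * B +
      3 * 1000000 ^ 2) =
      -(1000000 ^ 5 + 1000000 ^ 4 + 4 * 1000000 ^ 3 + 9 * 1000000 ^ 2 : ℝ)
        + (1000000 ^ 6 - 4 * 1000000 ^ 4 - 3 * 1000000 ^ 3 - 7 * 1000000 ^ 2 - 6 * 1000000) * d
        + (6 * 1000000 ^ 5 - 6 * 1000000 ^ 3 - 3 * 1000000 ^ 2 - 3 * 1000000) * d ^ 2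
        + (15 * 1000000 ^ 4 - 4 * 1000000 ^ 2 - 1000000) * d ^ 3 + (20 * 1000000 ^ 3 - 1000000) * d ^ 4
        + 15 * 1000000 ^ 2 * d ^ 5 + 6 * 1000000 * d ^ 6 + d ^ 7 := by
    rw [hBd]; ring
  have h2 : d ^ 2 ≤ (10000010000020000040000633957 / 10 ^ 34) ^ 2 := pow_le_pow_left₀ hd0 hdδ 2
  have h3 : d ^ 3 ≤ (10000010000020000040000633957 / 10 ^ 34) ^ 3 := pow_le_pow_left₀ hd0 hdδ 3
  have h4 : d ^ 4 ≤ (10000010000020000040000633957 / 10 ^ 34) ^ 4 := pow_le_pow_left₀ hd0 hdδ 4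
  have h5 : d ^ 5 ≤ (10000010000020000040000633957 / 10 ^ 34) ^ 5 := pow_le_pow_left₀ hd0 hdδ 5
  have h6 : d ^ 6 ≤ (10000010000020000040000633957 / 10 ^ 34) ^ 6 := pow_le_pow_left₀ hd0 hdδ 6
  have h7 : d ^ 7 ≤ (10000010000020000040000633957 / 10 ^ 34) ^ 7 := pow_le_pow_left₀ hd0 hdδ 7
  have hc1 : (1000000 ^ 6 - 4 * 1000000 ^ 4 - 3 * 1000000 ^ 3 - 7 * 1000000 ^ 2 - 6 * 1000000 : ℝ) * d ≤
      (1000000 ^ 6 - 4 * 1000000 ^ 4 - 3 * 1000000 ^ 3 - 7 * 1000000 ^ 2 - 6 * 1000000 : ℝ) *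
        (10000010000020000040000633957 / 10 ^ 34) := mul_le_mul_of_nonneg_left hdδ (by norm_num)
  have hc2 : (6 * 1000000 ^ 5 - 6 * 1000000 ^ 3 - 3 * 1000000 ^ 2 - 3 * 1000000 : ℝ) * d ^ 2 ≤
      (6 * 1000000 ^ 5 - 6 * 1000000 ^ 3 - 3 * 1000000 ^ 2 - 3 * 1000000 : ℝ) *
        (10000010000020000040000633957 / 10 ^ 34) ^ 2 := mul_le_mul_of_nonneg_left h2 (by norm_num)
  have hc3 : (15 * 1000000 ^ 4 - 4 * 1000000 ^ 2 - 1000000 : ℝ) * d ^ 3 ≤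
      (15 * 1000000 ^ 4 - 4 * 1000000 ^ 2 - 1000000 : ℝ) * (10000010000020000040000633957 / 10 ^ 34) ^ 3 :=
    mul_le_mul_of_nonneg_left h3 (by norm_num)
  have hc4 : (20 * 1000000 ^ 3 - 1000000 : ℝ) * d ^ 4 ≤ (20 * 1000000 ^ 3 - 1000000 : ℝ) *
      (10000010000020000040000633957 / 10 ^ 34) ^ 4 := mul_le_mul_of_nonneg_left h4 (by norm_num)
  have hc5 : (15 * 1000000 ^ 2 : ℝ) * d ^ 5 ≤ (15 * 1000000 ^ 2 : ℝ) * (10000010000020000040000633957 / 10 ^ 34) ^ 5 :=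
    mul_le_mul_of_nonneg_left h5 (by norm_num)
  have hc6 : (6 * 1000000 : ℝ) * d ^ 6 ≤ (6 * 1000000 : ℝ) * (10000010000020000040000633957 / 10 ^ 34) ^ 6 :=
    mul_le_mul_of_nonneg_left h6 (by norm_num)
  have hB7 : (1000000 : ℝ) ^ 7 ≤ B ^ 7 := pow_le_pow_left₀ (by norm_num) hlo 7
  have hx7 : (9 / 10 ^ 31 : ℝ) * 1000000 ^ 7 ≤ x * B ^ 7 := mul_le_mul hx hB7 (by norm_num) hx0
  have hnum : -(1000000 ^ 5 + 1000000 ^ 4 + 4 * 1000000 ^ 3 + 9 * 1000000 ^ 2 : ℝ)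
        + (1000000 ^ 6 - 4 * 1000000 ^ 4 - 3 * 1000000 ^ 3 - 7 * 1000000 ^ 2 - 6 * 1000000 : ℝ) *
          (10000010000020000040000633957 / 10 ^ 34)
        + (6 * 1000000 ^ 5 - 6 * 1000000 ^ 3 - 3 * 1000000 ^ 2 - 3 * 1000000 : ℝ) * (10000010000020000040000633957 / 10 ^ 34) ^ 2
        + (15 * 1000000 ^ 4 - 4 * 1000000 ^ 2 - 1000000 : ℝ) * (10000010000020000040000633957 / 10 ^ 34) ^ 3
        + (20 * 1000000 ^ 3 - 1000000 : ℝ) * (10000010000020000040000633957 / 10 ^ 34) ^ 4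
        + (15 * 1000000 ^ 2 : ℝ) * (10000010000020000040000633957 / 10 ^ 34) ^ 5
        + (6 * 1000000 : ℝ) * (10000010000020000040000633957 / 10 ^ 34) ^ 6
        + (10000010000020000040000633957 / 10 ^ 34) ^ 7
        < (9 / 10 ^ 31 : ℝ) * 1000000 ^ 7 := by
    norm_num
  linarith

/-- A class term `y^a/β^{2b}` at `y = 10⁶` is at least `10^{6a}/1000001^b`. [cite: BeatonBousquetMelouDeGierDuminilCopinGuttmann2014, Section 3.1, Proposition 5] -/
private theorem class_term_ge_fv (a b : ℕ) :
    (1000000 : ℝ) ^ a / 1000001 ^ b ≤ 1000000 ^ a / (wallRate 1000000 ^ 2) ^ b := by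
  have hlo : (1000000 : ℝ) ≤ wallRate 1000000 ^ 2 := le_sq_wallRate_fv (by norm_num)
  have hhi : wallRate 1000000 ^ 2 ≤ 1000000 + 1 / 1000000 + 8748 / 1000000 ^ 2 := wallRate_sq_le_sharp (by norm_num)
  have hBhi : wallRate 1000000 ^ 2 ≤ 1000001 := by
    have : (1 : ℝ) / 1000000 + 8748 / 1000000 ^ 2 ≤ 1 := by norm_num
    linarith
  exact div_le_div_of_nonneg_left (by positivity) (pow_pos (by linarith) _) (pow_le_pow_left₀ (by linarith) hBhi b)

/-- The visit monomial is monotone in the number of visits at `y = 10⁶`. [cite: BeatonBousquetMelouDeGierDuminilCopinGuttmann2014, Section 3.1] -/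
private theorem pow_visits_ge_fv {a v : ℕ} (hv : a ≤ v) (b : ℕ) :
    (1000000 : ℝ) ^ a / (wallRate 1000000 ^ 2) ^ b ≤ 1000000 ^ v / (wallRate 1000000 ^ 2) ^ b :=
  div_le_div_of_nonneg_right (pow_le_pow_right₀ (by norm_num) hv) (pow_nonneg (sq_nonneg _) _)

open Classical in
/-- The seven known blocks of length twelve at fugacity `y`: the hooked block and the six positive seeds give
`(6y + y²)/β¹² ≤ f₆(y)`, and any FURTHER irreducible block of length twelve adds its own monomial. [cite: MadrasSlade1993, Section 4.2, (4.2.2) (p. 91)] -/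
private theorem known_twelve_fv (hy : 0 ≤ y) {m : ℕ} (hm : m = 12) {T : Finset (ℕ → Site 2)} (hT : T ⊆ ipwb m)
    (hTq : Twelve.qw ∉ T) (hTW : Disjoint T (Finset.univ.image TwelveOne.W)) :
    ((∑ ω ∈ T, y ^ visits m ω) + (6 * y + y ^ 2)) / (wallRate y ^ 2) ^ 6 ≤ pwbLaw y 6 := by
  set S6 := Finset.univ.image TwelveOne.W with hS6
  have hq6 : Twelve.qw ∉ S6 := by
    intro h
    obtain ⟨i, -, hi⟩ := Finset.mem_image.1 h
    have hv1 : visits 12 (TwelveOne.W i) = 1 := TwelveOne.visits_W i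
    rw [hi, Twelve.visits_qw] at hv1
    exact absurd hv1 (by norm_num)
  have hsub : T ∪ insert Twelve.qw S6 ⊆ ipwb m := by
    refine Finset.union_subset hT (Finset.insert_subset_iff.2 ⟨qw_mem_ipwb hm, ?_⟩)
    rw [hS6]; exact image_twelveOne_subset_ipwb hm
  have hdisj : Disjoint T (insert Twelve.qw S6) := by
    rw [Finset.disjoint_insert_right]; exact ⟨hTq, hTW⟩
  have h := subset_div_le_pwbLaw_fv (s := 6) hy (by omega) hsub
  have hvq : visits m Twelve.qw = 2 := by rw [hm]; exact Twelve.visits_qw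
  rwa [Finset.sum_union hdisj, Finset.sum_insert hq6, hS6, sum_image_twelveOne hm, hvq,
    show y ^ 2 + 6 * y = 6 * y + y ^ 2 by ring] at h

open Classical in
/-- The three known two-visit blocks of length fourteen at fugacity `y`: `3y²/β¹⁴ ≤ f₇(y)`, and any FURTHER irreducible block of length
fourteen adds its own monomial. [cite: MadrasSlade1993, Section 4.2, (4.2.2) (p. 91)] -/
private theorem known_fourteen_fv (hy : 0 ≤ y) {m : ℕ} (hm : m = 14) {T : Finset (ℕ → Site 2)} (hT : T ⊆ ipwb m)
    (hd : Disjoint T (Finset.univ.image FourteenTwo.W)) :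
    ((∑ ω ∈ T, y ^ visits m ω) + 3 * y ^ 2) / (wallRate y ^ 2) ^ 7 ≤ pwbLaw y 7 := by
  have hsub : T ∪ Finset.univ.image FourteenTwo.W ⊆ ipwb m := Finset.union_subset hT (image_fourteenTwo_subset_ipwb hm)
  have h := subset_div_le_pwbLaw_fv (s := 7) hy (by omega) hsub
  rwa [Finset.sum_union hd, sum_image_fourteenTwo hm] at h

/-- The known blocks at `y = 10⁶` through order `y⁻⁵`: `y/β² ≤ f₁`, `f₃ = y/β⁶`, `f₄ = y/β⁸`, `f₅ = 3y/β¹⁰`, `(6y + y²)/β¹² ≤ f₆`, `3y²/β¹⁴ ≤ f₇`.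
[cite: MadrasSlade1993, Section 4.2, (4.2.2) (p. 91)] [cite: EntingJensen2009, Section 7.4.2, Fig. 7.10] -/
private theorem known_blocks5_fv :
    1000000 / wallRate 1000000 ^ 2 ≤ pwbLaw 1000000 1 ∧ pwbLaw 1000000 3 = 1000000 / wallRate 1000000 ^ 6 ∧
      pwbLaw 1000000 4 = 1000000 / wallRate 1000000 ^ 8 ∧ pwbLaw 1000000 5 = 3 * 1000000 / wallRate 1000000 ^ 10 ∧
      (6 * 1000000 + 1000000 ^ 2) / wallRate 1000000 ^ 12 ≤ pwbLaw 1000000 6 ∧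
      3 * 1000000 ^ 2 / wallRate 1000000 ^ 14 ≤ pwbLaw 1000000 7 := by
  classical
  refine ⟨div_sq_wallRate_le_pwbLaw_one_fv (by norm_num), pwbLaw_three _, pwbLaw_four_eq _, pwbLaw_five_eq _, ?_, ?_⟩
  · have h := known_twelve_fv (y := 1000000) (T := ∅) (by norm_num) rfl (Finset.empty_subset _) (by simp)
      (Finset.disjoint_empty_left _)
    have e12 : (wallRate 1000000 ^ 2) ^ 6 = wallRate 1000000 ^ 12 := by rw [← pow_mul]
    rwa [Finset.sum_empty, zero_add, e12] at h
  · have h := known_fourteen_fv (y := 1000000) (T := ∅) (by norm_num) rfl (Finset.empty_subset _) (Finset.disjoint_empty_left _)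
    have e14 : (wallRate 1000000 ^ 2) ^ 7 = wallRate 1000000 ^ 14 := by rw [← pow_mul]
    rwa [Finset.sum_empty, zero_add, e14] at h

/-! ### §3  The order-five analytic census: `N₆₁ = 6`, `N₇₂ = 3`, `N₈₃ = N₉₄ = N₁₀,₅ = N₁₁,₆ = 0` -/

open Classical in
/-- ★★★ **A one-visit irreducible positive wall bridge of length twelve is one of the six positive seeds** (door D2 of the lane WITHOUT a
step-by-step classification: a SEVENTH one-visit block would add `≥ y/β¹² ≈ 10⁻³⁰ > 9·10⁻³¹` to Kesten's identity at `y = 10⁶`, where the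
blocks through order `y⁻⁵` leave no such room under the sixth-order window).
[cite: MadrasSlade1993, Section 4.2, (4.2.4) and Theorem 4.2.2 (pp. 91–92)] [cite: Kesten1963SAW, Section 4] [cite: EntingJensen2009, Section 7.4.2, Fig. 7.10] -/
theorem exists_eq_twelveOne_W_of_mem_ipwb_twelve_of_visits_eq_one {m : ℕ} (hm : m = 12) (hω : ω ∈ ipwb m) (hv : visits m ω = 1) :
    ∃ i : Fin 6, ω = TwelveOne.W i := by
  by_contra hne
  push Not at hne
  have hni : ω ∉ Finset.univ.image TwelveOne.W := by
    intro h
    obtain ⟨i, -, he⟩ := Finset.mem_image.1 h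
    exact hne i he.symm
  have hnq : ω ≠ Twelve.qw := by
    intro h
    have : visits m ω = 2 := by rw [h, hm]; exact Twelve.visits_qw
    omega
  have hK := kesten_six_fv mu_four_lt_Y_fv
  obtain ⟨h1, h3, h4, h5, -, h7⟩ := known_blocks5_fv
  have hs := known_twelve_fv (y := 1000000) (T := {ω}) (by norm_num) hm (Finset.singleton_subset_iff.2 hω)
    (by rw [Finset.mem_singleton]; exact hnq.symm) (Finset.disjoint_singleton_left.2 hni)
  rw [Finset.sum_singleton, hv, pow_one, add_div] at hs
  have e12 : (wallRate 1000000 ^ 2) ^ 6 = wallRate 1000000 ^ 12 := by rw [← pow_mul]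
  have hx : (9 / 10 ^ 31 : ℝ) ≤ 1000000 / (wallRate 1000000 ^ 2) ^ 6 :=
    calc (9 / 10 ^ 31 : ℝ) ≤ 1000000 ^ 1 / 1000001 ^ 6 := by norm_num
      _ ≤ 1000000 ^ 1 / (wallRate 1000000 ^ 2) ^ 6 := class_term_ge_fv 1 6
      _ = _ := by rw [pow_one]
  rw [e12] at hs hx
  exact no_room5_fv hx (by linarith)

open Classical in
/-- ★★ The one-visit irreducible positive wall bridges of length twelve are EXACTLY the six positive seeds (as finite sets; symbolic length).
[cite: MadrasSlade1993, Section 4.2, Definition 4.2.1, (4.2.2)] [cite: EntingJensen2009, Section 7.4.2, Fig. 7.10] -/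
theorem oneVisit_ipwb_twelve_eq_image {m : ℕ} (hm : m = 12) :
    ((ipwb m).filter fun ω => visits m ω = 1) = Finset.univ.image TwelveOne.W := by
  ext ω
  rw [Finset.mem_filter]
  constructor
  · rintro ⟨hω, hv⟩
    obtain ⟨i, rfl⟩ := exists_eq_twelveOne_W_of_mem_ipwb_twelve_of_visits_eq_one hm hω hv
    exact Finset.mem_image_of_mem _ (Finset.mem_univ i)
  · intro h
    obtain ⟨i, -, rfl⟩ := Finset.mem_image.1 h
    exact ⟨TwelveOne.W_mem_ipwb hm i, by rw [hm]; exact TwelveOne.visits_W i⟩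

open Classical in
/-- ★★★ **`N₆₁ = 6`**: EXACTLY SIX irreducible positive wall bridges of length twelve have one surface visit (door D2 of the lane; symbolic length).
[cite: MadrasSlade1993, Section 4.2, Definition 4.2.1, (4.2.2) and Theorem 4.2.2 (pp. 91–92)] [cite: Kesten1963SAW, Section 4] -/
theorem card_oneVisit_ipwb_twelve_eq_six {m : ℕ} (hm : m = 12) : #((ipwb m).filter fun ω => visits m ω = 1) = 6 := by
  rw [oneVisit_ipwb_twelve_eq_image hm, card_image_twelveOne]

/-- ★★ **`N₆ = 7`**: the irreducible positive wall bridges of length twelve are the six positive seeds and the hooked block (symbolic length).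
[cite: MadrasSlade1993, Section 4.2, Definition 4.2.1, (4.2.2)] [cite: Kesten1963SAW, Section 4] -/
theorem card_ipwb_twelve_eq_seven {m : ℕ} (hm : m = 12) : #(ipwb m) = 7 := by
  classical
  rw [card_ipwb_twelve_eq hm, card_oneVisit_ipwb_twelve_eq_six hm]

open Classical in
/-- ★★ **A two-visit irreducible positive wall bridge of length fourteen is one of the three hooked blocks** (a FOURTH would add
`≥ y²/β¹⁴ ≈ 10⁻³⁰` at `y = 10⁶`). [cite: MadrasSlade1993, Section 4.2, (4.2.4) and Theorem 4.2.2 (pp. 91–92)] [cite: Kesten1963SAW, Section 4] [cite: EntingJensen2009, Section 7.4.2, Fig. 7.10] -/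
theorem exists_eq_fourteenTwo_W_of_mem_ipwb_fourteen_of_visits_eq_two {m : ℕ} (hm : m = 14) (hω : ω ∈ ipwb m) (hv : visits m ω = 2) :
    ∃ i : Fin 3, ω = FourteenTwo.W i := by
  by_contra hne
  push Not at hne
  have hK := kesten_six_fv mu_four_lt_Y_fv
  obtain ⟨h1, h3, h4, h5, h6, -⟩ := known_blocks5_fv
  have hdis : Disjoint ({ω} : Finset (ℕ → Site 2)) (Finset.univ.image FourteenTwo.W) := by
    rw [Finset.disjoint_singleton_left]
    intro h
    obtain ⟨i, -, he⟩ := Finset.mem_image.1 h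
    exact hne i he.symm
  have hs := known_fourteen_fv (y := 1000000) (T := {ω}) (by norm_num) hm (Finset.singleton_subset_iff.2 hω) hdis
  rw [Finset.sum_singleton, hv, add_div] at hs
  have e14 : (wallRate 1000000 ^ 2) ^ 7 = wallRate 1000000 ^ 14 := by rw [← pow_mul]
  have hx : (9 / 10 ^ 31 : ℝ) ≤ 1000000 ^ 2 / (wallRate 1000000 ^ 2) ^ 7 :=
    calc (9 / 10 ^ 31 : ℝ) ≤ 1000000 ^ 2 / 1000001 ^ 7 := by norm_num
      _ ≤ _ := class_term_ge_fv 2 7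
  rw [e14] at hs hx
  exact no_room5_fv hx (by linarith)

open Classical in
/-- ★★ The two-visit irreducible positive wall bridges of length fourteen are EXACTLY the three hooked blocks `FourteenTwo.W` (as finite sets;
symbolic length). [cite: MadrasSlade1993, Section 4.2, Definition 4.2.1, (4.2.2)] [cite: EntingJensen2009, Section 7.4.2, Fig. 7.10] -/
theorem twoVisit_ipwb_fourteen_eq_image {m : ℕ} (hm : m = 14) :
    ((ipwb m).filter fun ω => visits m ω = 2) = Finset.univ.image FourteenTwo.W := by
  ext ω
  rw [Finset.mem_filter]
  constructor
  · rintro ⟨hω, hv⟩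
    obtain ⟨i, rfl⟩ := exists_eq_fourteenTwo_W_of_mem_ipwb_fourteen_of_visits_eq_two hm hω hv
    exact Finset.mem_image_of_mem _ (Finset.mem_univ i)
  · intro h
    refine ⟨image_fourteenTwo_subset_ipwb hm h, ?_⟩
    obtain ⟨i, -, rfl⟩ := Finset.mem_image.1 h
    rw [hm]; exact FourteenTwo.visits_W i

open Classical in
/-- ★★ **`N₇₂ = 3`**: EXACTLY THREE irreducible positive wall bridges of length fourteen have two surface visits (symbolic length).
[cite: MadrasSlade1993, Section 4.2, Definition 4.2.1, (4.2.2) and Theorem 4.2.2 (pp. 91–92)] [cite: Kesten1963SAW, Section 4] -/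
theorem card_twoVisit_ipwb_fourteen_eq_three {m : ℕ} (hm : m = 14) : #((ipwb m).filter fun ω => visits m ω = 2) = 3 := by
  rw [twoVisit_ipwb_fourteen_eq_image hm, card_image_fourteenTwo]

/-- ★★ **Every irreducible positive wall bridge of length `16` has at most two visits** (`N₈₃ = 0`: a class `(8,3)` would add
`≥ y³/β¹⁶ ≈ 10⁻³⁰ > 9·10⁻³¹`).  (Census: `N₈₁ = 38`, `N₈₂ = 11` — not used.) [cite: MadrasSlade1993, Section 4.2, (4.2.4) and Theorem 4.2.2 (pp. 91–92)] [cite: Kesten1963SAW, Section 4] -/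
theorem visits_le_two_of_mem_ipwb_sixteen {m : ℕ} (hm : m = 16) (hω : ω ∈ ipwb m) : visits m ω ≤ 2 := by
  by_contra hne
  have hv3 : 3 ≤ visits m ω := by omega
  have hK := kesten_seven_fv mu_four_lt_Y_fv (s := 8) (by norm_num) (by norm_num) (by norm_num) (by norm_num) (by norm_num)
    (by norm_num)
  obtain ⟨h1, h3, h4, h5, h6, h7⟩ := known_blocks5_fv
  have hs := single_div_le_pwbLaw_fv (y := 1000000) (s := 8) (n := m) (by norm_num) (by omega) hω
  have hx : (9 / 10 ^ 31 : ℝ) ≤ 1000000 ^ visits m ω / (wallRate 1000000 ^ 2) ^ 8 :=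
    calc (9 / 10 ^ 31 : ℝ) ≤ 1000000 ^ 3 / 1000001 ^ 8 := by norm_num
      _ ≤ 1000000 ^ 3 / (wallRate 1000000 ^ 2) ^ 8 := class_term_ge_fv 3 8
      _ ≤ _ := pow_visits_ge_fv hv3 8
  exact no_room5_fv hx (by linarith)

/-- ★★ **Every irreducible positive wall bridge of length `18` has at most three visits** (`N₉₄ = 0`).  (Census: `N₉₃ = 1` — the bound is attained.)
[cite: MadrasSlade1993, Section 4.2, (4.2.4) and Theorem 4.2.2 (pp. 91–92)] [cite: Kesten1963SAW, Section 4] -/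
theorem visits_le_three_of_mem_ipwb_eighteen {m : ℕ} (hm : m = 18) (hω : ω ∈ ipwb m) : visits m ω ≤ 3 := by
  by_contra hne
  have hv4 : 4 ≤ visits m ω := by omega
  have hK := kesten_seven_fv mu_four_lt_Y_fv (s := 9) (by norm_num) (by norm_num) (by norm_num) (by norm_num) (by norm_num)
    (by norm_num)
  obtain ⟨h1, h3, h4, h5, h6, h7⟩ := known_blocks5_fv
  have hs := single_div_le_pwbLaw_fv (y := 1000000) (s := 9) (n := m) (by norm_num) (by omega) hω
  have hx : (9 / 10 ^ 31 : ℝ) ≤ 1000000 ^ visits m ω / (wallRate 1000000 ^ 2) ^ 9 :=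
    calc (9 / 10 ^ 31 : ℝ) ≤ 1000000 ^ 4 / 1000001 ^ 9 := by norm_num
      _ ≤ 1000000 ^ 4 / (wallRate 1000000 ^ 2) ^ 9 := class_term_ge_fv 4 9
      _ ≤ _ := pow_visits_ge_fv hv4 9
  exact no_room5_fv hx (by linarith)

/-- ★★ **Every irreducible positive wall bridge of length `20` has at most four visits** (`N₁₀,₅ = 0`).  (Census: `N₁₀ = {1:267, 2:99, 3:7}`.)
[cite: MadrasSlade1993, Section 4.2, (4.2.4) and Theorem 4.2.2 (pp. 91–92)] [cite: Kesten1963SAW, Section 4] -/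
theorem visits_le_four_of_mem_ipwb_twenty {m : ℕ} (hm : m = 20) (hω : ω ∈ ipwb m) : visits m ω ≤ 4 := by
  by_contra hne
  have hv5 : 5 ≤ visits m ω := by omega
  have hK := kesten_seven_fv mu_four_lt_Y_fv (s := 10) (by norm_num) (by norm_num) (by norm_num) (by norm_num) (by norm_num)
    (by norm_num)
  obtain ⟨h1, h3, h4, h5, h6, h7⟩ := known_blocks5_fv
  have hs := single_div_le_pwbLaw_fv (y := 1000000) (s := 10) (n := m) (by norm_num) (by omega) hω
  have hx : (9 / 10 ^ 31 : ℝ) ≤ 1000000 ^ visits m ω / (wallRate 1000000 ^ 2) ^ 10 :=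
    calc (9 / 10 ^ 31 : ℝ) ≤ 1000000 ^ 5 / 1000001 ^ 10 := by norm_num
      _ ≤ 1000000 ^ 5 / (wallRate 1000000 ^ 2) ^ 10 := class_term_ge_fv 5 10
      _ ≤ _ := pow_visits_ge_fv hv5 10
  exact no_room5_fv hx (by linarith)

/-- ★★ **Every irreducible positive wall bridge of length `22` has at most five visits** (`N₁₁,₆ = 0`).  (Census: `N₁₁ = {1:738, 2:295, 3:33}`.)
[cite: MadrasSlade1993, Section 4.2, (4.2.4) and Theorem 4.2.2 (pp. 91–92)] [cite: Kesten1963SAW, Section 4] -/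
theorem visits_le_five_of_mem_ipwb_twentytwo {m : ℕ} (hm : m = 22) (hω : ω ∈ ipwb m) : visits m ω ≤ 5 := by
  by_contra hne
  have hv6 : 6 ≤ visits m ω := by omega
  have hK := kesten_seven_fv mu_four_lt_Y_fv (s := 11) (by norm_num) (by norm_num) (by norm_num) (by norm_num) (by norm_num)
    (by norm_num)
  obtain ⟨h1, h3, h4, h5, h6, h7⟩ := known_blocks5_fv
  have hs := single_div_le_pwbLaw_fv (y := 1000000) (s := 11) (n := m) (by norm_num) (by omega) hω
  have hx : (9 / 10 ^ 31 : ℝ) ≤ 1000000 ^ visits m ω / (wallRate 1000000 ^ 2) ^ 11 :=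
    calc (9 / 10 ^ 31 : ℝ) ≤ 1000000 ^ 6 / 1000001 ^ 11 := by norm_num
      _ ≤ 1000000 ^ 6 / (wallRate 1000000 ^ 2) ^ 11 := class_term_ge_fv 6 11
      _ ≤ _ := pow_visits_ge_fv hv6 11
  exact no_room5_fv hx (by linarith)

/-- ★★ **Fifth-order visit deficiency**: every irreducible positive wall bridge of length `n ≥ 16` has at most `n/2 − 6` visits
(`2·visits + 12 ≤ n`): the census for `n = 16, 18, 20, 22`, the entropy bound `4·visits ≤ n + 2` for `n ≥ 24` (lengths are even).
[cite: MadrasSlade1993, Section 4.2, (4.2.4) and Theorem 4.2.2 (pp. 91–92), remark before (4.2.21) (p. 94)] [cite: Kesten1963SAW, Section 4] -/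
theorem two_mul_visits_add_twelve_le (hn : 16 ≤ n) (hω : ω ∈ ipwb n) : 2 * visits n ω + 12 ≤ n := by
  have hev := even_len_fv hω
  by_cases h16 : n = 16
  · have := visits_le_two_of_mem_ipwb_sixteen h16 hω; omega
  by_cases h18 : n = 18
  · have := visits_le_three_of_mem_ipwb_eighteen h18 hω; omega
  by_cases h20 : n = 20
  · have := visits_le_four_of_mem_ipwb_twenty h20 hω; omega
  by_cases h22 : n = 22
  · have := visits_le_five_of_mem_ipwb_twentytwo h22 hω; omega
  have h24 : 24 ≤ n := by omega
  have h4 := four_mul_visits_le hω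
  omega

/-- `visits ≤ n/2 − 6` on `ipwb n`, `n ≥ 16`. [cite: MadrasSlade1993, Section 4.2, (4.2.4) (p. 91)] -/
theorem visits_le_half_sub_six (hn : 16 ≤ n) (hω : ω ∈ ipwb n) : visits n ω ≤ n / 2 - 6 := by
  have := two_mul_visits_add_twelve_le hn hω
  omega

/-! ### §4  Laws: `Λ₁₂ = 6y + y²`, `Λ₁₄ = N₇₁ y + 3y²`, the envelope `f_s ≤ N_s/y⁶` for `s ≥ 8`, the excess beyond half-length eleven -/

/-- ★★ **`Λ₁₂(y) = 6y + y²`** (symbolic length). [cite: MadrasSlade1993, Section 4.2, (4.2.2) (p. 91)] [cite: Kesten1963SAW, Section 4] -/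
theorem IPWB_twelve_eq_six {m : ℕ} (hm : m = 12) (y : ℝ) : IPWB m y = 6 * y + y ^ 2 := by
  classical
  rw [IPWB_twelve_eq hm, card_oneVisit_ipwb_twelve_eq_six hm]
  norm_num

/-- ★★ **`f₆(y) = (6y + y²)/β(y)¹²`** — the renewal law is explicit through half-length six: `y/β², 0, y/β⁶, y/β⁸, 3y/β¹⁰, (6y + y²)/β¹²`.
[cite: MadrasSlade1993, Section 4.2, (4.2.2), (4.2.4) (p. 91)] [cite: Kesten1963SAW, Section 4] -/
theorem pwbLaw_six_eq_six (y : ℝ) : pwbLaw y 6 = (6 * y + y ^ 2) / wallRate y ^ 12 := by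
  obtain ⟨m, hm⟩ : ∃ m : ℕ, m = 12 := ⟨_, rfl⟩
  have e : pwbLaw y 6 = IPWB m y / wallRate y ^ m := by rw [pwbLaw, hm]
  rw [e, IPWB_twelve_eq_six hm, hm]

open Classical in
/-- ★★ **`Λ₁₄(y) = N₇₁·y + 3y²`** with `N₇₁ = #` one-visit irreducible blocks of length fourteen (symbolic; a census gives `15`).
[cite: MadrasSlade1993, Section 4.2, (4.2.2) (p. 91)] [cite: Kesten1963SAW, Section 4] -/
theorem IPWB_fourteen_eq {m : ℕ} (hm : m = 14) (y : ℝ) :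
    IPWB m y = #((ipwb m).filter fun ω => visits m ω = 1) * y + 3 * y ^ 2 := by
  rw [IPWB, ← Finset.sum_filter_add_sum_filter_not (ipwb m) (fun ω => visits m ω = 1)]
  have hneg : ((ipwb m).filter fun ω => ¬ visits m ω = 1) = (ipwb m).filter fun ω => visits m ω = 2 := by
    refine Finset.filter_congr fun ω hω => ?_
    have h1 := one_le_visits_fv hω
    have h2 := visits_le_two_of_mem_ipwb_fourteen hm hω
    omega
  rw [hneg, twoVisit_ipwb_fourteen_eq_image hm, sum_image_fourteenTwo hm,
    Finset.sum_congr rfl fun ω hω => by rw [(Finset.mem_filter.1 hω).2, pow_one], Finset.sum_const, nsmul_eq_mul]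

open Classical in
/-- ★ **`f₇(y) = (N₇₁·y + 3y²)/β(y)¹⁴`** (symbolic `N₇₁`). [cite: MadrasSlade1993, Section 4.2, (4.2.2), (4.2.4) (p. 91)] -/
theorem pwbLaw_seven_eq {m : ℕ} (hm : m = 14) (y : ℝ) :
    pwbLaw y 7 = (#((ipwb m).filter fun ω => visits m ω = 1) * y + 3 * y ^ 2) / wallRate y ^ 14 := by
  have e : pwbLaw y 7 = IPWB m y / wallRate y ^ m := by rw [pwbLaw, hm]
  rw [e, IPWB_fourteen_eq hm, hm]

/-- `Λ_n(y) ≤ #(ipwb n)·y^{n/2 − 6}` for `n ≥ 16`, `y ≥ 1`. [cite: MadrasSlade1993, Section 4.2, (4.2.2) (p. 91)] -/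
theorem IPWB_le_card_mul_pow_six (hn : 16 ≤ n) (hy : 1 ≤ y) : IPWB n y ≤ #(ipwb n) * y ^ (n / 2 - 6) := by
  rw [IPWB]
  have h := Finset.sum_le_card_nsmul (ipwb n) (fun ω => y ^ visits n ω) (y ^ (n / 2 - 6)) fun ω hω =>
    pow_le_pow_right₀ hy (visits_le_half_sub_six hn hω)
  rwa [nsmul_eq_mul] at h

/-- ★ `f_s(y) ≤ #(ipwb 2s)/y⁶` for `s ≥ 8`, `y ≥ 1` (symbolic length `m = 2s`). [cite: MadrasSlade1993, Section 4.2, (4.2.2), (4.2.4) (p. 91)] [cite: BeatonBousquetMelouDeGierDuminilCopinGuttmann2014, Section 3.1, Proposition 5] -/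
theorem pwbLaw_le_card_div_pow_six {m s : ℕ} (hm : m = 2 * s) (hs : 8 ≤ s) (hy : 1 ≤ y) : pwbLaw y s ≤ #(ipwb m) / y ^ 6 := by
  have hy0 : 0 < y := by linarith
  have e : pwbLaw y s = IPWB m y / wallRate y ^ m := by rw [pwbLaw, hm]
  rw [e]
  have hden : y ^ s ≤ wallRate y ^ m := by rw [hm]; exact pow_le_wallRate_pow_fv hy0 s
  calc IPWB m y / wallRate y ^ m ≤ #(ipwb m) * y ^ (m / 2 - 6) / wallRate y ^ m :=
        div_le_div_of_nonneg_right (IPWB_le_card_mul_pow_six (by omega) hy) (pow_nonneg (wallRate_pos y).le m)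
    _ ≤ #(ipwb m) * y ^ (m / 2 - 6) / y ^ s := div_le_div_of_nonneg_left (by positivity) (by positivity) hden
    _ = #(ipwb m) / y ^ 6 := by
        rw [show m / 2 - 6 = s - 6 by omega, div_eq_div_iff (by positivity) (by positivity)]
        rw [show (#(ipwb m) : ℝ) * y ^ (s - 6) * y ^ 6 = #(ipwb m) * (y ^ (s - 6) * y ^ 6) by ring, ← pow_add,
          show s - 6 + 6 = s by omega]

/-- ★ `f_s(y) ≤ 9^s/y⁶` for `s ≥ 8`, `y ≥ 1`. [cite: MadrasSlade1993, Section 1.2, (1.2.3); Section 4.2, (4.2.2) (p. 91)] -/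
theorem pwbLaw_le_nine_pow_div_pow_six {s : ℕ} (hs : 8 ≤ s) (hy : 1 ≤ y) : pwbLaw y s ≤ 9 ^ s / y ^ 6 := by
  obtain ⟨m, hm⟩ : ∃ m : ℕ, m = 2 * s := ⟨_, rfl⟩
  have h := pwbLaw_le_card_div_pow_six hm hs hy
  have hc : (#(ipwb m) : ℝ) ≤ 9 ^ s := by
    calc (#(ipwb m) : ℝ) ≤ 3 ^ m := card_ipwb_le_three_pow m
      _ = 9 ^ s := by rw [hm, pow_mul]; norm_num
  exact h.trans (div_le_div_of_nonneg_right hc (by positivity))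

/-- ★ **The four order-six head terms are `O(y⁻⁶)`**: `7f₈ + 8f₉ + 9f₁₀ + 10f₁₁ ≤ 348592346658/y⁶` (`= (7·9⁸ + 8·9⁹ + 9·9¹⁰ + 10·9¹¹)/y⁶`), `y ≥ 1`.
[cite: MadrasSlade1993, Section 4.2, (4.2.2)–(4.2.5) (p. 91)] -/
theorem head_seven_mul_pwbLaw_le (hy : 1 ≤ y) :
    7 * pwbLaw y 8 + 8 * pwbLaw y 9 + 9 * pwbLaw y 10 + 10 * pwbLaw y 11 ≤ 348592346658 / y ^ 6 := by
  have h8 := pwbLaw_le_nine_pow_div_pow_six (s := 8) (by norm_num) hy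
  have h9 := pwbLaw_le_nine_pow_div_pow_six (s := 9) (by norm_num) hy
  have h10 := pwbLaw_le_nine_pow_div_pow_six (s := 10) (by norm_num) hy
  have h11 := pwbLaw_le_nine_pow_div_pow_six (s := 11) (by norm_num) hy
  have e : (348592346658 : ℝ) / y ^ 6 = 7 * (9 ^ 8 / y ^ 6) + 8 * (9 ^ 9 / y ^ 6) + 9 * (9 ^ 10 / y ^ 6) + 10 * (9 ^ 11 / y ^ 6) := by
    norm_num; ring
  rw [e]
  linarith

open Classical in
/-- ★ **`6f₇ ≤ 18·y²/β¹⁴ + 28697814/y⁶`** for `y ≥ 1` (`f₇ = (N₇₁ y + 3y²)/β¹⁴`, `N₇₁ ≤ #(ipwb 14) ≤ 3¹⁴ = 4782969`, `β¹⁴ ≥ y⁷`).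
[cite: MadrasSlade1993, Section 1.2, (1.2.3); Section 4.2, (4.2.2)–(4.2.5) (p. 91)] -/
theorem six_mul_pwbLaw_seven_le (hy : 1 ≤ y) : 6 * pwbLaw y 7 ≤ 18 * (y ^ 2 / wallRate y ^ 14) + 28697814 / y ^ 6 := by
  have hy0 : 0 < y := by linarith
  obtain ⟨m, hm⟩ : ∃ m : ℕ, m = 14 := ⟨_, rfl⟩
  rw [pwbLaw_seven_eq hm, add_div]
  have hN : (#((ipwb m).filter fun ω => visits m ω = 1) : ℝ) ≤ 4782969 := by
    calc (#((ipwb m).filter fun ω => visits m ω = 1) : ℝ) ≤ #(ipwb m) := by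
          exact_mod_cast Finset.card_le_card (Finset.filter_subset _ _)
      _ ≤ 3 ^ m := card_ipwb_le_three_pow m
      _ = 4782969 := by rw [hm]; norm_num
  have hden : y ^ 7 ≤ wallRate y ^ 14 := pow_le_wallRate_pow_fv hy0 7
  have h1 : (#((ipwb m).filter fun ω => visits m ω = 1) : ℝ) * y / wallRate y ^ 14 ≤ 4782969 * y / y ^ 7 :=
    calc (#((ipwb m).filter fun ω => visits m ω = 1) : ℝ) * y / wallRate y ^ 14 ≤ 4782969 * y / wallRate y ^ 14 :=
          div_le_div_of_nonneg_right (mul_le_mul_of_nonneg_right hN hy0.le) (pow_nonneg (wallRate_pos y).le 14)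
      _ ≤ 4782969 * y / y ^ 7 := div_le_div_of_nonneg_left (by positivity) (by positivity) hden
  have e : (4782969 : ℝ) * y / y ^ 7 = 4782969 / y ^ 6 := by
    rw [div_eq_div_iff (by positivity) (by positivity)]; ring
  rw [e] at h1
  have e6 : (28697814 : ℝ) / y ^ 6 = 6 * (4782969 / y ^ 6) := by ring
  have e3 : 6 * (3 * y ^ 2 / wallRate y ^ 14) = 18 * (y ^ 2 / wallRate y ^ 14) := by ring
  rw [e6, mul_add, e3]
  have h6 := mul_le_mul_of_nonneg_left h1 (show (0 : ℝ) ≤ 6 by norm_num)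
  linarith

/-- **Excess decomposition at order five**: for `y > μ⁴`,
`Σ_{j ≥ 0} (j + 11) f_{j+12}(y) = m(y) − 1 − (2f₃ + 3f₄ + 4f₅ + 5f₆ + 6f₇ + 7f₈ + 8f₉ + 9f₁₀ + 10f₁₁)`.
[cite: MadrasSlade1993, Section 4.2, (4.2.4)–(4.2.5) and Theorem 4.2.2 (pp. 91–92)] [cite: Feller1968, XIII.3] -/
theorem hasSum_excess_tail_twelve (hy : hexConnectiveConstant ^ 4 < y) :
    HasSum (fun j : ℕ => ((j : ℝ) + 11) * pwbLaw y (j + 12))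
      (pwbMean y - 1 - (2 * pwbLaw y 3 + 3 * pwbLaw y 4 + 4 * pwbLaw y 5 + 5 * pwbLaw y 6 + 6 * pwbLaw y 7 + 7 * pwbLaw y 8 +
        8 * pwbLaw y 9 + 9 * pwbLaw y 10 + 10 * pwbLaw y 11)) := by
  have ht := (hasSum_nat_add_iff' 2).2 (hasSum_excess_tail_ten hy)
  have hsum : ∑ i ∈ Finset.range 2, ((i : ℝ) + 9) * pwbLaw y (i + 10) = 9 * pwbLaw y 10 + 10 * pwbLaw y 11 := by
    simp only [Finset.sum_range_succ, Finset.sum_range_zero]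
    push_cast
    ring
  rw [hsum] at ht
  have e : pwbMean y - 1 - (2 * pwbLaw y 3 + 3 * pwbLaw y 4 + 4 * pwbLaw y 5 + 5 * pwbLaw y 6 + 6 * pwbLaw y 7 + 7 * pwbLaw y 8 +
        8 * pwbLaw y 9 + 9 * pwbLaw y 10 + 10 * pwbLaw y 11) =
      pwbMean y - 1 - (2 * pwbLaw y 3 + 3 * pwbLaw y 4 + 4 * pwbLaw y 5 + 5 * pwbLaw y 6 + 6 * pwbLaw y 7 + 7 * pwbLaw y 8 +
        8 * pwbLaw y 9) - (9 * pwbLaw y 10 + 10 * pwbLaw y 11) := by ring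
  rw [e]
  refine ht.congr_fun fun j => ?_
  rw [show j + 2 + 10 = j + 12 by omega]
  push_cast
  ring

/-- `θ = μ²/√y ≤ ½` once `y ≥ 48`. [cite: MadrasSlade1993, Section 4.2, remark before (4.2.21) (p. 94)] [cite: DuminilCopinSmirnov2012, Theorem 1] -/
private theorem theta_le_half_fv (hy : 48 ≤ y) : hexConnectiveConstant ^ 2 / Real.sqrt y ≤ 1 / 2 := by
  have hy0 : 0 < y := by linarith
  have hs0 : 0 < Real.sqrt y := Real.sqrt_pos.2 hy0
  have hy2 : Real.sqrt y ^ 2 = y := Real.sq_sqrt hy0.le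
  have h4 : (2 * hexConnectiveConstant ^ 2) ^ 2 ≤ Real.sqrt y ^ 2 := by
    rw [hy2]
    have e : (2 * hexConnectiveConstant ^ 2) ^ 2 = 4 * hexConnectiveConstant ^ 4 := by ring
    rw [e]
    have := mu_four_lt_twelve_fv
    linarith
  have h2 : 2 * hexConnectiveConstant ^ 2 ≤ Real.sqrt y :=
    (pow_le_pow_iff_left₀ (by positivity) hs0.le two_ne_zero).1 h4
  rw [div_le_iff₀ hs0]
  linarith

/-- ★ **Tail bound at order five**: for `y ≥ 48`, `m(y) − 1 − (2f₃ + … + 10f₁₁) ≤ 24 μ²⁶/(y⁵√y)`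
(envelope `f_s ≤ μ²√y θ^s`, `θ ≤ ½`, `Σ_j (j + 11)θ^j = θ/(1 − θ)² + 11/(1 − θ) ≤ 24`, prefactor `μ²√y θ¹² = μ²⁶/(y⁵√y)`).
[cite: MadrasSlade1993, Section 4.2, Theorem 4.2.2 and remark before (4.2.21) (pp. 91–94)] [cite: Feller1968, XIII.3] -/
theorem excess_tail_twelve_le (hy : 48 ≤ y) :
    pwbMean y - 1 - (2 * pwbLaw y 3 + 3 * pwbLaw y 4 + 4 * pwbLaw y 5 + 5 * pwbLaw y 6 + 6 * pwbLaw y 7 + 7 * pwbLaw y 8 +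
        8 * pwbLaw y 9 + 9 * pwbLaw y 10 + 10 * pwbLaw y 11) ≤ 24 * hexConnectiveConstant ^ 26 / (y ^ 5 * Real.sqrt y) := by
  have hy0 : 0 < y := by linarith
  have hy1 : 1 ≤ y := by linarith
  have hμ : hexConnectiveConstant ^ 4 < y := mu_four_lt_twelve_fv.trans_le (by linarith)
  have hθhalf := theta_le_half_fv hy
  have hs0 : 0 < Real.sqrt y := Real.sqrt_pos.2 hy0
  have hμ2 : 0 < hexConnectiveConstant ^ 2 := pow_pos hexConnectiveConstant_pos 2
  have hθ0 : 0 < hexConnectiveConstant ^ 2 / Real.sqrt y := div_pos hμ2 hs0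
  have hθ1 : hexConnectiveConstant ^ 2 / Real.sqrt y < 1 := by linarith
  have ht := hasSum_excess_tail_twelve hμ
  have hG1 : HasSum (fun j : ℕ => (j : ℝ) * (hexConnectiveConstant ^ 2 / Real.sqrt y) ^ j)
      ((hexConnectiveConstant ^ 2 / Real.sqrt y) / (1 - hexConnectiveConstant ^ 2 / Real.sqrt y) ^ 2) :=
    hasSum_coe_mul_geometric_of_norm_lt_one (by rw [Real.norm_of_nonneg hθ0.le]; exact hθ1)
  have hG0 : HasSum (fun j : ℕ => (hexConnectiveConstant ^ 2 / Real.sqrt y) ^ j)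
      (1 - hexConnectiveConstant ^ 2 / Real.sqrt y)⁻¹ := hasSum_geometric_of_lt_one hθ0.le hθ1
  have hG : HasSum (fun j : ℕ => ((j : ℝ) + 11) *
      (hexConnectiveConstant ^ 2 * Real.sqrt y * (hexConnectiveConstant ^ 2 / Real.sqrt y) ^ (j + 12)))
      (hexConnectiveConstant ^ 2 * Real.sqrt y * (hexConnectiveConstant ^ 2 / Real.sqrt y) ^ 12 *
        ((hexConnectiveConstant ^ 2 / Real.sqrt y) / (1 - hexConnectiveConstant ^ 2 / Real.sqrt y) ^ 2 +
          11 * (1 - hexConnectiveConstant ^ 2 / Real.sqrt y)⁻¹)) := by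
    have h := (hG1.add (hG0.mul_left 11)).mul_left
      (hexConnectiveConstant ^ 2 * Real.sqrt y * (hexConnectiveConstant ^ 2 / Real.sqrt y) ^ 12)
    exact h.congr_fun fun j => by ring
  have hle := hasSum_le (fun j => mul_le_mul_of_nonneg_left (pwbLaw_le_geom hy1 (j + 12)) (by positivity)) ht hG
  set θ := hexConnectiveConstant ^ 2 / Real.sqrt y with hθ_def
  have h1θ : 1 / 2 ≤ 1 - θ := by linarith
  have hinv : (1 - θ)⁻¹ ≤ 2 := by
    rw [inv_le_comm₀ (by linarith) (by norm_num)]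
    linarith
  have hq : 1 / 4 ≤ (1 - θ) ^ 2 := by nlinarith
  have hdiv : θ / (1 - θ) ^ 2 ≤ 2 := by
    rw [div_le_iff₀ (by positivity)]
    linarith
  have hsum : θ / (1 - θ) ^ 2 + 11 * (1 - θ)⁻¹ ≤ 24 := by linarith
  set s := Real.sqrt y with hs_def
  have hys : y = s ^ 2 := (Real.sq_sqrt hy0.le).symm
  have hE0 : 0 ≤ hexConnectiveConstant ^ 2 * s * θ ^ 12 := by positivity
  have hEθ : hexConnectiveConstant ^ 2 * s * θ ^ 12 = hexConnectiveConstant ^ 26 / (y ^ 5 * s) := by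
    rw [show y ^ 5 * s = s ^ 11 by rw [hys]; ring, hθ_def, div_pow, ← mul_div_assoc,
      div_eq_div_iff (pow_ne_zero 12 hs0.ne') (pow_ne_zero 11 hs0.ne')]
    ring
  calc pwbMean y - 1 - (2 * pwbLaw y 3 + 3 * pwbLaw y 4 + 4 * pwbLaw y 5 + 5 * pwbLaw y 6 + 6 * pwbLaw y 7 + 7 * pwbLaw y 8 +
        8 * pwbLaw y 9 + 9 * pwbLaw y 10 + 10 * pwbLaw y 11)
      ≤ hexConnectiveConstant ^ 2 * s * θ ^ 12 * (θ / (1 - θ) ^ 2 + 11 * (1 - θ)⁻¹) := hle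
    _ ≤ hexConnectiveConstant ^ 2 * s * θ ^ 12 * 24 := mul_le_mul_of_nonneg_left hsum hE0
    _ = 24 * hexConnectiveConstant ^ 26 / (y ^ 5 * s) := by rw [hEθ]; ring

open Classical in
/-- ★ **Lower bound at order five** (`y > μ⁴`): `18·(y⁷/β¹⁴) ≤ y⁵ (m(y) − 1 − 2y/β⁶ − 3y/β⁸ − 12y/β¹⁰ − (30y + 5y²)/β¹²)` — in
`m − 1 = 2f₃ + 3f₄ + 4f₅ + 5f₆ + 6f₇ + Σ_{j≥0}(j+7)f_{j+8}` every term is nonnegative, `f₅ = 3y/β¹⁰`, `f₆ = (6y + y²)/β¹²` and `f₇ ≥ 3y²/β¹⁴`.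
[cite: MadrasSlade1993, Section 4.2, (4.2.4)–(4.2.5) and Theorem 4.2.2 (pp. 91–92)] [cite: Feller1968, XIII.3] -/
theorem eighteen_mul_le_pow_five_mul (hy : hexConnectiveConstant ^ 4 < y) :
    18 * (y ^ 7 / wallRate y ^ 14) ≤
      y ^ 5 * (pwbMean y - 1 - 2 * y / wallRate y ^ 6 - 3 * y / wallRate y ^ 8 - 12 * y / wallRate y ^ 10 -
        (30 * y + 5 * y ^ 2) / wallRate y ^ 12) := by
  have hy0 : 0 < y := lt_of_le_of_lt (by positivity) hy
  obtain ⟨m, hm⟩ : ∃ m : ℕ, m = 14 := ⟨_, rfl⟩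
  have hnn : 0 ≤ pwbMean y - 1 - (2 * pwbLaw y 3 + 3 * pwbLaw y 4 + 4 * pwbLaw y 5 + 5 * pwbLaw y 6 + 6 * pwbLaw y 7) :=
    (hasSum_excess_tail_eight hy).nonneg fun j => mul_nonneg (by positivity) (pwbLaw_nonneg hy0.le _)
  have h7 := known_fourteen_fv (T := ∅) hy0.le hm (Finset.empty_subset _) (Finset.disjoint_empty_left _)
  have e14 : (wallRate y ^ 2) ^ 7 = wallRate y ^ 14 := by rw [← pow_mul]
  rw [Finset.sum_empty, zero_add, e14] at h7
  rw [pwbLaw_three y, pwbLaw_four_eq y, pwbLaw_five_eq y, pwbLaw_six_eq_six y] at hnn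
  have hle : 18 * (y ^ 2 / wallRate y ^ 14) ≤ pwbMean y - 1 - 2 * y / wallRate y ^ 6 - 3 * y / wallRate y ^ 8 -
      12 * y / wallRate y ^ 10 - (30 * y + 5 * y ^ 2) / wallRate y ^ 12 := by
    have e1 : 2 * y / wallRate y ^ 6 = 2 * (y / wallRate y ^ 6) := by ring
    have e2 : 3 * y / wallRate y ^ 8 = 3 * (y / wallRate y ^ 8) := by ring
    have e3 : 12 * y / wallRate y ^ 10 = 4 * (3 * y / wallRate y ^ 10) := by ring
    have e4 : (30 * y + 5 * y ^ 2) / wallRate y ^ 12 = 5 * ((6 * y + y ^ 2) / wallRate y ^ 12) := by ring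
    have e5 : 3 * y ^ 2 / wallRate y ^ 14 = 3 * (y ^ 2 / wallRate y ^ 14) := by ring
    rw [e5] at h7
    rw [e1, e2, e3, e4]
    linarith
  have hmul := mul_le_mul_of_nonneg_left hle (pow_pos hy0 5).le
  have e : y ^ 5 * (18 * (y ^ 2 / wallRate y ^ 14)) = 18 * (y ^ 7 / wallRate y ^ 14) := by ring
  rw [e] at hmul
  exact hmul

/-- ★★ **Upper bound at order five** (`y ≥ 48`):
`y⁵ (m(y) − 1 − 2y/β⁶ − 3y/β⁸ − 12y/β¹⁰ − (30y + 5y²)/β¹²) ≤ 18·(y⁷/β¹⁴) + 348621044472/y + 24 μ²⁶/√y`.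
[cite: MadrasSlade1993, Section 4.2, (4.2.2)–(4.2.5) and Theorem 4.2.2 (pp. 91–92)] [cite: Kesten1963SAW, Section 4] -/
theorem pow_five_mul_pwbMean_sub_le (hy : 48 ≤ y) :
    y ^ 5 * (pwbMean y - 1 - 2 * y / wallRate y ^ 6 - 3 * y / wallRate y ^ 8 - 12 * y / wallRate y ^ 10 -
        (30 * y + 5 * y ^ 2) / wallRate y ^ 12) ≤
      18 * (y ^ 7 / wallRate y ^ 14) + 348621044472 / y + 24 * hexConnectiveConstant ^ 26 / Real.sqrt y := by
  have hy0 : 0 < y := by linarith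
  have hy1 : 1 ≤ y := by linarith
  have hs0 : 0 < Real.sqrt y := Real.sqrt_pos.2 hy0
  have ht := excess_tail_twelve_le hy
  have hh := head_seven_mul_pwbLaw_le hy1
  have h7 := six_mul_pwbLaw_seven_le hy1
  rw [pwbLaw_three, pwbLaw_four_eq, pwbLaw_five_eq, pwbLaw_six_eq_six] at ht
  have hle : pwbMean y - 1 - 2 * y / wallRate y ^ 6 - 3 * y / wallRate y ^ 8 - 12 * y / wallRate y ^ 10 -
      (30 * y + 5 * y ^ 2) / wallRate y ^ 12 ≤
      18 * (y ^ 2 / wallRate y ^ 14) + 348621044472 / y ^ 6 + 24 * hexConnectiveConstant ^ 26 / (y ^ 5 * Real.sqrt y) := by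
    have e1 : 2 * y / wallRate y ^ 6 = 2 * (y / wallRate y ^ 6) := by ring
    have e2 : 3 * y / wallRate y ^ 8 = 3 * (y / wallRate y ^ 8) := by ring
    have e3 : 12 * y / wallRate y ^ 10 = 4 * (3 * y / wallRate y ^ 10) := by ring
    have e4 : (30 * y + 5 * y ^ 2) / wallRate y ^ 12 = 5 * ((6 * y + y ^ 2) / wallRate y ^ 12) := by ring
    have e5 : (348621044472 : ℝ) / y ^ 6 = 28697814 / y ^ 6 + 348592346658 / y ^ 6 := by rw [← add_div]; norm_num
    rw [e1, e2, e3, e4, e5]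
    linarith
  have hm := mul_le_mul_of_nonneg_left hle (pow_pos hy0 5).le
  have f1 : y ^ 5 * (18 * (y ^ 2 / wallRate y ^ 14)) = 18 * (y ^ 7 / wallRate y ^ 14) := by ring
  have f2 : y ^ 5 * (348621044472 / y ^ 6) = 348621044472 / y := by
    rw [mul_div_assoc', div_eq_div_iff (by positivity) (by positivity)]; ring
  have f3 : y ^ 5 * (24 * hexConnectiveConstant ^ 26 / (y ^ 5 * Real.sqrt y)) = 24 * hexConnectiveConstant ^ 26 / Real.sqrt y := by
    rw [mul_div_assoc', div_eq_div_iff (by positivity) (by positivity)]; ring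
  calc y ^ 5 * (pwbMean y - 1 - 2 * y / wallRate y ^ 6 - 3 * y / wallRate y ^ 8 - 12 * y / wallRate y ^ 10 -
        (30 * y + 5 * y ^ 2) / wallRate y ^ 12)
      ≤ y ^ 5 * (18 * (y ^ 2 / wallRate y ^ 14) + 348621044472 / y ^ 6 + 24 * hexConnectiveConstant ^ 26 / (y ^ 5 * Real.sqrt y)) := hm
    _ = 18 * (y ^ 7 / wallRate y ^ 14) + 348621044472 / y + 24 * hexConnectiveConstant ^ 26 / Real.sqrt y := by
        rw [mul_add, mul_add, f1, f2, f3]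

/-- ★ The order-five window (`y ≥ 48`). [cite: MadrasSlade1993, Section 4.2, (4.2.5) and Theorem 4.2.2 (pp. 91–92)] -/
theorem pow_five_mul_pwbMean_sub_mem_Icc (hy : 48 ≤ y) :
    y ^ 5 * (pwbMean y - 1 - 2 * y / wallRate y ^ 6 - 3 * y / wallRate y ^ 8 - 12 * y / wallRate y ^ 10 -
        (30 * y + 5 * y ^ 2) / wallRate y ^ 12) ∈
      Set.Icc (18 * (y ^ 7 / wallRate y ^ 14))
        (18 * (y ^ 7 / wallRate y ^ 14) + 348621044472 / y + 24 * hexConnectiveConstant ^ 26 / Real.sqrt y) :=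
  ⟨eighteen_mul_le_pow_five_mul (mu_four_lt_twelve_fv.trans_le (by linarith)), pow_five_mul_pwbMean_sub_le hy⟩

/-! ### §5  THE FIFTH-ORDER LIMITS: `→ 18` (mixed form) and `m(y) = 1 + 2/y² + 3/y³ + 11/y⁴ + 30/y⁵ + o(y⁻⁵)` -/

/-- `y⁷/β(y)¹⁴ → 1` (`β ∼ √y`). [cite: BeatonBousquetMelouDeGierDuminilCopinGuttmann2014, Section 3.1, Proposition 5 (arXiv v5 p. 9)] -/
theorem tendsto_pow_seven_div_wallRate_pow_fourteen : Tendsto (fun y : ℝ => y ^ 7 / wallRate y ^ 14) atTop (𝓝 1) := by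
  have h1 : Tendsto (fun y : ℝ => ((wallRate y / Real.sqrt y) ^ 14)⁻¹) atTop (𝓝 ((1 : ℝ) ^ 14)⁻¹) :=
    (tendsto_wallRate_div_sqrt.pow 14).inv₀ (by norm_num)
  rw [one_pow, inv_one] at h1
  refine h1.congr' ?_
  filter_upwards [eventually_gt_atTop (0 : ℝ)] with y hy
  have hs : Real.sqrt y ^ 14 = y ^ 7 := by
    rw [show (14 : ℕ) = 2 * 7 by norm_num, pow_mul, Real.sq_sqrt hy.le]
  rw [div_pow, hs, inv_div]

/-- ★★★ **`y⁵ (m(y) − 1 − 2y/β⁶ − 3y/β⁸ − 12y/β¹⁰ − (30y + 5y²)/β¹²) → 18`** (`y → ∞`), `18 = 6·N₇₂`: beyond the blocks of length `≤ 12`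
(now ALL explicit), the three hooked fourteens carry the whole fifth order of the renewal mean; the other blocks of half-length `7, …, 11` are
`O(y⁻⁶)` by the order-five census and the rest is `O(y^{−11/2})` by the envelope.
[cite: MadrasSlade1993, Section 4.2, (4.2.5) and Theorem 4.2.2 (pp. 91–92)] [cite: Kesten1963SAW, Section 4] [cite: JansevanRensburg2000, Section 3.3.2, Lemma 3.20] -/
theorem tendsto_pow_five_mul_pwbMean_sub :
    Tendsto (fun y : ℝ => y ^ 5 * (pwbMean y - 1 - 2 * y / wallRate y ^ 6 - 3 * y / wallRate y ^ 8 - 12 * y / wallRate y ^ 10 -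
      (30 * y + 5 * y ^ 2) / wallRate y ^ 12)) atTop (𝓝 18) := by
  have h0 : Tendsto (fun y : ℝ => 18 * (y ^ 7 / wallRate y ^ 14)) atTop (𝓝 18) := by
    simpa using tendsto_pow_seven_div_wallRate_pow_fourteen.const_mul 18
  have h1 : Tendsto (fun y : ℝ => (348621044472 : ℝ) / y) atTop (𝓝 0) := tendsto_const_nhds.div_atTop tendsto_id
  have h2 : Tendsto (fun y : ℝ => 24 * hexConnectiveConstant ^ 26 / Real.sqrt y) atTop (𝓝 0) :=
    tendsto_const_nhds.div_atTop Real.tendsto_sqrt_atTop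
  have hup : Tendsto (fun y : ℝ => 18 * (y ^ 7 / wallRate y ^ 14) + 348621044472 / y + 24 * hexConnectiveConstant ^ 26 / Real.sqrt y)
      atTop (𝓝 18) := by
    simpa using (h0.add h1).add h2
  refine tendsto_of_tendsto_of_tendsto_of_le_of_le' h0 hup ?_ ?_
  · filter_upwards [eventually_gt_atTop (hexConnectiveConstant ^ 4)] with y hy
    exact eighteen_mul_le_pow_five_mul hy
  · filter_upwards [eventually_ge_atTop (48 : ℝ)] with y hy
    exact pow_five_mul_pwbMean_sub_le hy

/-- ★ For every `a > 18`, eventually `y⁵ (…) ≤ a`; for every `ε > 0`, eventually `18·(y⁷/β¹⁴)`-floor form `18 − ε ≤ y⁵ (…)`.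
[cite: MadrasSlade1993, Section 4.2, (4.2.5) (p. 91)] -/
theorem eventually_pow_five_mul_pwbMean_mem {ε : ℝ} (hε : 0 < ε) :
    ∀ᶠ y : ℝ in atTop, y ^ 5 * (pwbMean y - 1 - 2 * y / wallRate y ^ 6 - 3 * y / wallRate y ^ 8 - 12 * y / wallRate y ^ 10 -
      (30 * y + 5 * y ^ 2) / wallRate y ^ 12) ∈ Set.Ioo (18 - ε) (18 + ε) :=
  tendsto_pow_five_mul_pwbMean_sub.eventually (Ioo_mem_nhds (by linarith) (by linarith))

/-- ★ **`y³ (1 − y/β(y)²) − y → 1`** — the fourth-order window of the tree in ratio form: with `e = β² − y − 1/y − 1/y²` (`y³e → 2`),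
`y³(1 − y/β²) − y = (y/β²)·(1 − 1/y − 1/y² + y²e − e)`. [cite: BeatonBousquetMelouDeGierDuminilCopinGuttmann2014, Section 3.1, Proposition 5 (arXiv v5 p. 9) and p. 10] -/
theorem tendsto_cube_mul_one_sub_div_sub : Tendsto (fun y : ℝ => y ^ 3 * (1 - y / wallRate y ^ 2) - y) atTop (𝓝 1) := by
  have he3 := tendsto_cube_mul_wallRate_sq_sub_sub
  have hinv : Tendsto (fun y : ℝ => y⁻¹) atTop (𝓝 0) := tendsto_inv_atTop_zero
  have he2 : Tendsto (fun y : ℝ => y ^ 3 * (wallRate y ^ 2 - y - 1 / y - 1 / y ^ 2) * y⁻¹) atTop (𝓝 0) := by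
    simpa using he3.mul hinv
  have he0 : Tendsto (fun y : ℝ => y ^ 3 * (wallRate y ^ 2 - y - 1 / y - 1 / y ^ 2) * (y⁻¹) ^ 3) atTop (𝓝 0) := by
    simpa using he3.mul (hinv.pow 3)
  have hb : Tendsto (fun y : ℝ => 1 - y⁻¹ - (y⁻¹) ^ 2 + y ^ 3 * (wallRate y ^ 2 - y - 1 / y - 1 / y ^ 2) * y⁻¹ -
      y ^ 3 * (wallRate y ^ 2 - y - 1 / y - 1 / y ^ 2) * (y⁻¹) ^ 3) atTop (𝓝 (1 - 0 - 0 ^ 2 + 0 - 0)) :=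
    ((((tendsto_const_nhds (x := (1 : ℝ))).sub hinv).sub (hinv.pow 2)).add he2).sub he0
  have h := tendsto_div_wallRate_sq.mul hb
  norm_num at h
  refine h.congr' ?_
  filter_upwards [eventually_gt_atTop (0 : ℝ)] with y hy
  have hw : wallRate y ≠ 0 := (wallRate_pos y).ne'
  have hy' : y ≠ 0 := hy.ne'
  field_simp
  ring

/-- **The dip term to fifth order**: `y⁵·(2y/β⁶) − 2y³ + 6y → −6` (with `r = y/β²`, `Q = y³(1 − r) − y`:
`y⁵·2y/β⁶ − 2y³ + 6y = −2Q(1 + r + r²) + 2·y(1 − r)·(2 + r)`, `Q → 1`, `r → 1`, `y(1 − r) → 0`).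
[cite: BeatonBousquetMelouDeGierDuminilCopinGuttmann2014, Section 3.1, Proposition 5 (arXiv v5 p. 9)] [cite: MadrasSlade1993, Section 4.2, (4.2.2) (p. 91)] -/
theorem tendsto_pow_five_mul_two_mul_div_sub :
    Tendsto (fun y : ℝ => y ^ 5 * (2 * y / wallRate y ^ 6) - 2 * y ^ 3 + 6 * y) atTop (𝓝 (-6)) := by
  have hr := tendsto_div_wallRate_sq
  have hQ := tendsto_cube_mul_one_sub_div_sub
  have hy1r : Tendsto (fun y : ℝ => y ^ 2 * (1 - y / wallRate y ^ 2) * y⁻¹) atTop (𝓝 0) := by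
    simpa using tendsto_sq_mul_one_sub_div_wallRate_sq.mul tendsto_inv_atTop_zero
  have h := ((hQ.mul ((tendsto_const_nhds (x := (1 : ℝ))).add (hr.add (hr.pow 2)))).const_mul (-2)).add
    ((hy1r.mul ((tendsto_const_nhds (x := (2 : ℝ))).add hr)).const_mul 2)
  have e : (-2 : ℝ) * (1 * (1 + (1 + 1 ^ 2))) + 2 * (0 * (2 + 1)) = -6 := by norm_num
  rw [e] at h
  refine h.congr' ?_
  filter_upwards [eventually_gt_atTop (0 : ℝ)] with y hy
  have hw : wallRate y ≠ 0 := (wallRate_pos y).ne'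
  have hy' : y ≠ 0 := hy.ne'
  field_simp
  ring

/-- **The flat-excursion term to fifth order**: `y⁵·(3y/β⁸) − 3y² → −12` (`= −3·y²(1 − r)·(1 + r + r² + r³)`).
[cite: BeatonBousquetMelouDeGierDuminilCopinGuttmann2014, Section 3.1, Proposition 5 (arXiv v5 p. 9)] [cite: MadrasSlade1993, Section 4.2, (4.2.2) (p. 91)] -/
theorem tendsto_pow_five_mul_three_mul_div_sub :
    Tendsto (fun y : ℝ => y ^ 5 * (3 * y / wallRate y ^ 8) - 3 * y ^ 2) atTop (𝓝 (-12)) := by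
  have hr := tendsto_div_wallRate_sq
  have h := (tendsto_sq_mul_one_sub_div_wallRate_sq.mul
    ((tendsto_const_nhds (x := (1 : ℝ))).add (hr.add ((hr.pow 2).add (hr.pow 3))))).const_mul (-3)
  have e : (-3 : ℝ) * (1 * (1 + (1 + (1 ^ 2 + 1 ^ 3)))) = -12 := by norm_num
  rw [e] at h
  refine h.congr' ?_
  filter_upwards [eventually_gt_atTop (0 : ℝ)] with y hy
  have hw : wallRate y ≠ 0 := (wallRate_pos y).ne'
  field_simp
  ring

/-- **The tens to fifth order**: `y⁵·(12y/β¹⁰) − 12y → 0` (`= −12·y(1 − r)·(1 + r + r² + r³ + r⁴)`).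
[cite: BeatonBousquetMelouDeGierDuminilCopinGuttmann2014, Section 3.1, Proposition 5 (arXiv v5 p. 9)] [cite: MadrasSlade1993, Section 4.2, (4.2.2) (p. 91)] -/
theorem tendsto_pow_five_mul_twelve_mul_div_sub :
    Tendsto (fun y : ℝ => y ^ 5 * (12 * y / wallRate y ^ 10) - 12 * y) atTop (𝓝 0) := by
  have hr := tendsto_div_wallRate_sq
  have hy1r : Tendsto (fun y : ℝ => y ^ 2 * (1 - y / wallRate y ^ 2) * y⁻¹) atTop (𝓝 0) := by
    simpa using tendsto_sq_mul_one_sub_div_wallRate_sq.mul tendsto_inv_atTop_zero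
  have h := (hy1r.mul ((tendsto_const_nhds (x := (1 : ℝ))).add (hr.add ((hr.pow 2).add ((hr.pow 3).add (hr.pow 4)))))).const_mul (-12)
  have e : (-12 : ℝ) * (0 * (1 + (1 + (1 ^ 2 + (1 ^ 3 + 1 ^ 4))))) = 0 := by norm_num
  rw [e] at h
  refine h.congr' ?_
  filter_upwards [eventually_gt_atTop (0 : ℝ)] with y hy
  have hw : wallRate y ≠ 0 := (wallRate_pos y).ne'
  have hy' : y ≠ 0 := hy.ne'
  field_simp
  ring

/-- **The twelves to fifth order**: `y⁵·((30y + 5y²)/β¹²) − 5y → 30` (`= 30r⁶ − 5·y(1 − r)·(1 + r + … + r⁵)`).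
[cite: BeatonBousquetMelouDeGierDuminilCopinGuttmann2014, Section 3.1, Proposition 5 (arXiv v5 p. 9)] [cite: MadrasSlade1993, Section 4.2, (4.2.2) (p. 91)] -/
theorem tendsto_pow_five_mul_twelves_sub :
    Tendsto (fun y : ℝ => y ^ 5 * ((30 * y + 5 * y ^ 2) / wallRate y ^ 12) - 5 * y) atTop (𝓝 30) := by
  have hr := tendsto_div_wallRate_sq
  have hy1r : Tendsto (fun y : ℝ => y ^ 2 * (1 - y / wallRate y ^ 2) * y⁻¹) atTop (𝓝 0) := by
    simpa using tendsto_sq_mul_one_sub_div_wallRate_sq.mul tendsto_inv_atTop_zero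
  have h := ((hr.pow 6).const_mul 30).add
    ((hy1r.mul ((tendsto_const_nhds (x := (1 : ℝ))).add (hr.add ((hr.pow 2).add ((hr.pow 3).add ((hr.pow 4).add (hr.pow 5))))))).const_mul (-5))
  have e : (30 : ℝ) * 1 ^ 6 + -5 * (0 * (1 + (1 + (1 ^ 2 + (1 ^ 3 + (1 ^ 4 + 1 ^ 5)))))) = 30 := by norm_num
  rw [e] at h
  refine h.congr' ?_
  filter_upwards [eventually_gt_atTop (0 : ℝ)] with y hy
  have hw : wallRate y ≠ 0 := (wallRate_pos y).ne'
  have hy' : y ≠ 0 := hy.ne'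
  field_simp
  ring

/-- ★★★ **`y⁵ (m(y) − 1 − 2/y² − 3/y³ − 11/y⁴) → 30`**, i.e. **`m(y) = 1 + 2/y² + 3/y³ + 11/y⁴ + 30/y⁵ + o(y⁻⁵)`** (`y → ∞`):
`30 = 18 − 6 − 12 + 0 + 30` (the hooked fourteens, the dip's and the flat excursion's own corrections, the twelves `6·N₆₁ − 6`),
equivalently `30 = Σ_s s·N_{s,s−5} − 27 = 6·6 + 7·3 − 27`.
[cite: MadrasSlade1993, Section 4.2, (4.2.5) and Theorem 4.2.2 (pp. 91–92)] [cite: Kesten1963SAW, Section 4] [cite: EntingJensen2009, Section 7.4.2, Fig. 7.10] -/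
theorem tendsto_pow_five_mul_pwbMean_sub_four_terms :
    Tendsto (fun y : ℝ => y ^ 5 * (pwbMean y - 1 - 2 / y ^ 2 - 3 / y ^ 3 - 11 / y ^ 4)) atTop (𝓝 30) := by
  have h := (((tendsto_pow_five_mul_pwbMean_sub.add tendsto_pow_five_mul_two_mul_div_sub).add
    tendsto_pow_five_mul_three_mul_div_sub).add tendsto_pow_five_mul_twelve_mul_div_sub).add tendsto_pow_five_mul_twelves_sub
  have e : (18 : ℝ) + -6 + -12 + 0 + 30 = 30 := by norm_num
  rw [e] at h
  refine h.congr' ?_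
  filter_upwards [eventually_gt_atTop (0 : ℝ)] with y hy
  have hy' : y ≠ 0 := hy.ne'
  have e2 : y ^ 5 * (2 / y ^ 2) = 2 * y ^ 3 := by
    rw [mul_div_assoc', div_eq_iff (by positivity)]; ring
  have e3 : y ^ 5 * (3 / y ^ 3) = 3 * y ^ 2 := by
    rw [mul_div_assoc', div_eq_iff (by positivity)]; ring
  have e4 : y ^ 5 * (11 / y ^ 4) = 11 * y := by
    rw [mul_div_assoc', div_eq_iff (by positivity)]; ring
  calc y ^ 5 * (pwbMean y - 1 - 2 * y / wallRate y ^ 6 - 3 * y / wallRate y ^ 8 - 12 * y / wallRate y ^ 10 -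
          (30 * y + 5 * y ^ 2) / wallRate y ^ 12) +
        (y ^ 5 * (2 * y / wallRate y ^ 6) - 2 * y ^ 3 + 6 * y) + (y ^ 5 * (3 * y / wallRate y ^ 8) - 3 * y ^ 2) +
        (y ^ 5 * (12 * y / wallRate y ^ 10) - 12 * y) + (y ^ 5 * ((30 * y + 5 * y ^ 2) / wallRate y ^ 12) - 5 * y)
      = y ^ 5 * (pwbMean y - 1) - 2 * y ^ 3 - 3 * y ^ 2 - 11 * y := by ring
    _ = y ^ 5 * (pwbMean y - 1 - 2 / y ^ 2 - 3 / y ^ 3 - 11 / y ^ 4) := by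
        rw [show y ^ 5 * (pwbMean y - 1 - 2 / y ^ 2 - 3 / y ^ 3 - 11 / y ^ 4) =
          y ^ 5 * (pwbMean y - 1) - y ^ 5 * (2 / y ^ 2) - y ^ 5 * (3 / y ^ 3) - y ^ 5 * (11 / y ^ 4) by ring, e2, e3, e4]

/-- ★ **Asymptotic equivalence** `m(y) − 1 − 2/y² − 3/y³ − 11/y⁴ ∼ 30/y⁵` (`y → ∞`). [cite: MadrasSlade1993, Section 4.2, Theorem 4.2.2 (pp. 91–92)] [cite: Kesten1963SAW, Section 4] -/
theorem isEquivalent_pwbMean_sub_four_terms :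
    (fun y : ℝ => pwbMean y - 1 - 2 / y ^ 2 - 3 / y ^ 3 - 11 / y ^ 4) ~[atTop] fun y : ℝ => 30 / y ^ 5 := by
  have hz : ∀ᶠ y : ℝ in atTop, (30 : ℝ) / y ^ 5 ≠ 0 := by
    filter_upwards [eventually_gt_atTop (0 : ℝ)] with y hy
    positivity
  refine (isEquivalent_iff_tendsto_one hz).2 ?_
  have h := tendsto_pow_five_mul_pwbMean_sub_four_terms.div_const 30
  rw [show ((30 : ℝ) / 30) = 1 by norm_num] at h
  refine h.congr' ?_
  filter_upwards [eventually_gt_atTop (0 : ℝ)] with y hy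
  simp only [Pi.div_apply]
  rw [div_div_eq_mul_div]
  ring

/-! ## Edition 2, part II — the visit mean and the contact density to fifth order

### §6.0 Private helpers for part II -/

/-- `m(y) → 1`. [cite: MadrasSlade1993, Section 4.2, Theorem 4.2.2 (pp. 91–92)] -/
private theorem tendsto_pwbMean_df : Tendsto pwbMean atTop (𝓝 1) := by
  have h0 : Tendsto (fun y : ℝ => y ^ 2 * (pwbMean y - 1) * (y ^ 2)⁻¹) atTop (𝓝 (2 * 0)) :=
    tendsto_sq_mul_pwbMean_sub_one.mul (tendsto_pow_atTop two_ne_zero).inv_tendsto_atTop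
  have h1 : Tendsto (fun y : ℝ => y ^ 2 * (pwbMean y - 1) * (y ^ 2)⁻¹ + 1) atTop (𝓝 (2 * 0 + 1)) := h0.add_const 1
  rw [mul_zero, zero_add] at h1
  refine h1.congr' ?_
  filter_upwards [eventually_gt_atTop (0 : ℝ)] with y hy
  field_simp
  ring

/-- `y·(m(y) − 1) → 0`. [cite: MadrasSlade1993, Section 4.2, Theorem 4.2.2 (pp. 91–92)] -/
private theorem tendsto_mul_pwbMean_sub_one_df : Tendsto (fun y : ℝ => y * (pwbMean y - 1)) atTop (𝓝 0) := by
  have h := tendsto_sq_mul_pwbMean_sub_one.mul tendsto_inv_atTop_zero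
  rw [mul_zero] at h
  refine h.congr' ?_
  filter_upwards [eventually_gt_atTop (0 : ℝ)] with y hy
  field_simp

/-! ### §6 The visit-excess polynomials `Λ^v − Λ` at lengths twelve and fourteen, and their envelope from length sixteen on -/

open Classical in
/-- ★ **`Λ^v₁₂(y) − Λ₁₂(y) = y²`** (symbolic length): only the hooked block visits twice («FOURTH-EXACT-MEAN»), all other blocks of length
twelve visit once. [cite: MadrasSlade1993, Section 4.2, (4.2.2) (p. 91)] [cite: Kesten1963SAW, Section 4] -/
theorem IPWBV_sub_IPWB_twelve {m : ℕ} (hm : m = 12) (y : ℝ) : IPWBV m y - IPWB m y = y ^ 2 := by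
  rw [IPWBV_sub_IPWB_eq_sum, ← Finset.sum_filter_add_sum_filter_not (ipwb m) (fun ω => visits m ω = 1)]
  have hneg : ((ipwb m).filter fun ω => ¬ visits m ω = 1) = (ipwb m).filter fun ω => visits m ω = 2 := by
    refine Finset.filter_congr fun ω hω => ?_
    have h1 := one_le_visits_of_mem_ipwb hω
    have h2 := visits_le_two_of_mem_ipwb_twelve hm hω
    omega
  have hvq : visits m Twelve.qw = 2 := by rw [hm]; exact Twelve.visits_qw
  rw [hneg, twoVisit_ipwb_twelve_eq_singleton hm, Finset.sum_singleton, hvq,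
    Finset.sum_eq_zero fun ω hω => by rw [(Finset.mem_filter.1 hω).2]; push_cast; ring]
  push_cast
  ring

open Classical in
/-- ★ **`Λ^v₁₄(y) − Λ₁₄(y) = 3y²`** (symbolic length): the three hooked fourteens visit twice («FIFTH-EXACT-MEAN»), all other blocks of length
fourteen visit once. [cite: MadrasSlade1993, Section 4.2, (4.2.2) (p. 91)] [cite: Kesten1963SAW, Section 4] -/
theorem IPWBV_sub_IPWB_fourteen {m : ℕ} (hm : m = 14) (y : ℝ) : IPWBV m y - IPWB m y = 3 * y ^ 2 := by
  rw [IPWBV_sub_IPWB_eq_sum, ← Finset.sum_filter_add_sum_filter_not (ipwb m) (fun ω => visits m ω = 1)]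
  have hneg : ((ipwb m).filter fun ω => ¬ visits m ω = 1) = (ipwb m).filter fun ω => visits m ω = 2 := by
    refine Finset.filter_congr fun ω hω => ?_
    have h1 := one_le_visits_of_mem_ipwb hω
    have h2 := visits_le_two_of_mem_ipwb_fourteen hm hω
    omega
  have hv : ∀ i : Fin 3, visits m (FourteenTwo.W i) = 2 := by rw [hm]; exact FourteenTwo.visits_W
  rw [hneg, twoVisit_ipwb_fourteen_eq_image hm, Finset.sum_image fun i _ j _ h => FourteenTwo.W_injective h,
    Finset.sum_congr rfl fun (i : Fin 3) _ => by rw [hv i]]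
  rw [Finset.sum_eq_zero fun ω hω => by rw [(Finset.mem_filter.1 hω).2]; push_cast; ring, zero_add, Finset.sum_const,
    Finset.card_univ, Fintype.card_fin, nsmul_eq_mul]
  push_cast
  ring

/-- **Envelope of the visit excess from length sixteen on**: `Λ^v_n(y) − Λ_n(y) ≤ (n/2 − 7)·#(ipwb n)·y^{n/2 − 6}` for `n ≥ 16`, `y ≥ 1`
(each block has `1 ≤ visits ≤ n/2 − 6`). [cite: MadrasSlade1993, Section 4.2, (4.2.2) and remark before (4.2.21) (pp. 91–94)] -/
theorem IPWBV_sub_IPWB_le_of_sixteen_le (hn : 16 ≤ n) (hy : 1 ≤ y) :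
    IPWBV n y - IPWB n y ≤ ((n / 2 - 7 : ℕ) : ℝ) * #(ipwb n) * y ^ (n / 2 - 6) := by
  rw [IPWBV_sub_IPWB_eq_sum]
  have h := Finset.sum_le_card_nsmul (ipwb n) (fun ω => ((visits n ω : ℝ) - 1) * y ^ visits n ω)
    (((n / 2 - 7 : ℕ) : ℝ) * y ^ (n / 2 - 6)) fun ω hω => by
    have h1 := one_le_visits_of_mem_ipwb hω
    have h2 := visits_le_half_sub_six hn hω
    have hv : ((visits n ω : ℝ) - 1) ≤ ((n / 2 - 7 : ℕ) : ℝ) := by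
      have : visits n ω - 1 ≤ n / 2 - 7 := by omega
      have e : ((visits n ω : ℝ) - 1) = ((visits n ω - 1 : ℕ) : ℝ) := by push_cast [h1]; ring
      rw [e]; exact_mod_cast this
    exact mul_le_mul hv (pow_le_pow_right₀ hy h2) (by positivity) (by positivity)
  rw [nsmul_eq_mul] at h
  calc _ ≤ (#(ipwb n) : ℝ) * (((n / 2 - 7 : ℕ) : ℝ) * y ^ (n / 2 - 6)) := h
    _ = _ := by ring

/-- ★ `(Λ^v − Λ)_{2s}(y)/β(y)^{2s} ≤ (s − 7)·9^s/y⁶` for `8 ≤ s`, `y ≥ 1` (`#(ipwb 2s) ≤ 3^{2s}`, `β^{2s} ≥ y^s`).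
[cite: MadrasSlade1993, Section 1.2, (1.2.3); Section 4.2, (4.2.2) (p. 91)] -/
theorem visitExcess_term_le_nine_pow {s : ℕ} (hs : 8 ≤ s) (hy : 1 ≤ y) :
    (IPWBV (2 * s) y - IPWB (2 * s) y) / wallRate y ^ (2 * s) ≤ ((s : ℝ) - 7) * 9 ^ s / y ^ 6 := by
  have hy0 : 0 < y := by linarith
  have h1 := IPWBV_sub_IPWB_le_of_sixteen_le (n := 2 * s) (by omega) hy
  rw [show 2 * s / 2 - 7 = s - 7 by omega, show 2 * s / 2 - 6 = s - 6 by omega] at h1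
  have hc : (#(ipwb (2 * s)) : ℝ) ≤ 9 ^ s := by
    calc (#(ipwb (2 * s)) : ℝ) ≤ 3 ^ (2 * s) := card_ipwb_le_three_pow _
      _ = 9 ^ s := by rw [pow_mul]; norm_num
  have hs7 : ((s - 7 : ℕ) : ℝ) = (s : ℝ) - 7 := by push_cast [show 7 ≤ s by omega]; ring
  have h2 : IPWBV (2 * s) y - IPWB (2 * s) y ≤ ((s : ℝ) - 7) * 9 ^ s * y ^ (s - 6) := by
    rw [hs7] at h1
    have hs0 : (0 : ℝ) ≤ (s : ℝ) - 7 := by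
      have : (7 : ℝ) ≤ s := by exact_mod_cast (show 7 ≤ s by omega)
      linarith
    calc _ ≤ ((s : ℝ) - 7) * #(ipwb (2 * s)) * y ^ (s - 6) := h1
      _ ≤ ((s : ℝ) - 7) * 9 ^ s * y ^ (s - 6) := by gcongr
  have hden : y ^ s ≤ wallRate y ^ (2 * s) := pow_le_wallRate_pow_fv hy0 s
  have hnum0 : 0 ≤ ((s : ℝ) - 7) * 9 ^ s * y ^ (s - 6) := by
    have : (7 : ℝ) ≤ s := by exact_mod_cast (show 7 ≤ s by omega)
    have hs0 : (0 : ℝ) ≤ (s : ℝ) - 7 := by linarith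
    positivity
  calc (IPWBV (2 * s) y - IPWB (2 * s) y) / wallRate y ^ (2 * s) ≤ ((s : ℝ) - 7) * 9 ^ s * y ^ (s - 6) / wallRate y ^ (2 * s) :=
        div_le_div_of_nonneg_right h2 (pow_nonneg (wallRate_pos y).le _)
    _ ≤ ((s : ℝ) - 7) * 9 ^ s * y ^ (s - 6) / y ^ s := div_le_div_of_nonneg_left hnum0 (by positivity) hden
    _ = ((s : ℝ) - 7) * 9 ^ s / y ^ 6 := by
        rw [div_eq_div_iff (by positivity) (by positivity)]
        rw [show ((s : ℝ) - 7) * 9 ^ s * y ^ (s - 6) * y ^ 6 = ((s : ℝ) - 7) * 9 ^ s * (y ^ (s - 6) * y ^ 6) by ring, ← pow_add,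
          show s - 6 + 6 = s by omega]

/-! ### §7 `V − 1` to fifth order: the series beyond half-length seven and the two explicit terms -/

/-- **The visit-excess series beyond half-length seven** (`y > μ⁴`; symbolic lengths `12`, `14`):
`Σ_{j ≥ 0} (Λ^v − Λ)_{2(j+8)}/β^{2(j+8)} = V − 1 − y²/β¹² − 3y²/β¹⁴` — the terms `s ≤ 5` vanish identically (one visit), `s = 6, 7` are explicit.
[cite: MadrasSlade1993, Section 4.2, (4.2.4)–(4.2.5) and Theorem 4.2.2 (pp. 91–92)] [cite: Kesten1963SAW, Section 4] -/
theorem hasSum_visitExcess_sixteen (hy : hexConnectiveConstant ^ 4 < y) :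
    HasSum (fun j : ℕ => (IPWBV (2 * (j + 8)) y - IPWB (2 * (j + 8)) y) / wallRate y ^ (2 * (j + 8)))
      (pwbVisitMean y - 1 - y ^ 2 / wallRate y ^ 12 - 3 * y ^ 2 / wallRate y ^ 14) := by
  -- lengths symbolic (`m₁ = 10`, `m₂ = 12`, `m₃ = 14`): no closed `ipwb 10` is ever unfolded by the elaborator
  obtain ⟨m₁, hm₁⟩ : ∃ m : ℕ, m = 10 := ⟨_, rfl⟩
  obtain ⟨m₂, hm₂⟩ : ∃ m : ℕ, m = 12 := ⟨_, rfl⟩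
  obtain ⟨m₃, hm₃⟩ : ∃ m : ℕ, m = 14 := ⟨_, rfl⟩
  have h := (hasSum_nat_add_iff' 2).2 (hasSum_visitExcess_nat_add hy hm₁)
  have e10 : IPWBV m₁ y - IPWB m₁ y = 0 := by
    rw [IPWBV_eq_IPWB_of_visits_eq_one (fun ω hω => visits_eq_one_of_mem_ipwb_ten hm₁ hω), sub_self]
  have e6 : (IPWBV (2 * (0 + 6)) y - IPWB (2 * (0 + 6)) y) / wallRate y ^ (2 * (0 + 6)) = y ^ 2 / wallRate y ^ 12 := by
    rw [show 2 * (0 + 6) = m₂ by omega, IPWBV_sub_IPWB_twelve hm₂, hm₂]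
  have e7 : (IPWBV (2 * (1 + 6)) y - IPWB (2 * (1 + 6)) y) / wallRate y ^ (2 * (1 + 6)) = 3 * y ^ 2 / wallRate y ^ 14 := by
    rw [show 2 * (1 + 6) = m₃ by omega, IPWBV_sub_IPWB_fourteen hm₃, hm₃]
  have hsum : ∑ i ∈ Finset.range 2, (IPWBV (2 * (i + 6)) y - IPWB (2 * (i + 6)) y) / wallRate y ^ (2 * (i + 6)) =
      y ^ 2 / wallRate y ^ 12 + 3 * y ^ 2 / wallRate y ^ 14 := by
    rw [Finset.sum_range_succ, Finset.sum_range_succ, Finset.sum_range_zero, zero_add, e6, e7]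
  rw [hsum, e10, zero_div, sub_zero] at h
  have e : pwbVisitMean y - 1 - y ^ 2 / wallRate y ^ 12 - 3 * y ^ 2 / wallRate y ^ 14 =
      pwbVisitMean y - 1 - (y ^ 2 / wallRate y ^ 12 + 3 * y ^ 2 / wallRate y ^ 14) := by ring
  rw [e]
  refine h.congr_fun fun j => ?_
  rw [show j + 2 + 6 = j + 8 by omega]

/-- ★★ **Lower bound** (`y > μ⁴`): `y²/β¹² + 3y²/β¹⁴ ≤ V(y) − 1` (every visit-excess term is nonnegative).
[cite: MadrasSlade1993, Section 4.2, (4.2.4)–(4.2.5) (p. 91)] [cite: Kesten1963SAW, Section 4] -/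
theorem pwbVisitMean_sub_one_ge (hy : hexConnectiveConstant ^ 4 < y) :
    y ^ 2 / wallRate y ^ 12 + 3 * y ^ 2 / wallRate y ^ 14 ≤ pwbVisitMean y - 1 := by
  have hy0 : 0 ≤ y := by have := four_le_mu_four_fv; linarith
  have h := (hasSum_visitExcess_sixteen hy).nonneg fun j =>
    div_nonneg (sub_nonneg.2 (IPWB_le_IPWBV _ hy0)) (pow_nonneg (wallRate_pos y).le _)
  linarith

/-- ★★ **Upper bound** (`y ≥ 48`): `V(y) − 1 ≤ y²/β¹² + 3y²/β¹⁴ + 136802479338/y⁶ + 12 μ²⁶/(y⁵√y)` — the four census terms `s = 8, …, 11`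
(`Σ (s − 7)9^s = 136802479338`) plus HALF of «FIFTH-EXACT-MEAN»'s tail `Σ_{s ≥ 12}(s − 1)f_s ≤ 24μ²⁶/(y⁵√y)` (entropy: `Λ^v − Λ ≤ ((s−1)/2)Λ`).
[cite: MadrasSlade1993, Section 4.2, (4.2.4)–(4.2.5), Theorem 4.2.2 and remark before (4.2.21) (pp. 91–94)] [cite: Kesten1963SAW, Section 4] -/
theorem pwbVisitMean_sub_one_le_five (hy : 48 ≤ y) :
    pwbVisitMean y - 1 ≤ y ^ 2 / wallRate y ^ 12 + 3 * y ^ 2 / wallRate y ^ 14 + 136802479338 / y ^ 6 +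
      12 * hexConnectiveConstant ^ 26 / (y ^ 5 * Real.sqrt y) := by
  have hy0 : 0 < y := by linarith
  have hy1 : 1 ≤ y := by linarith
  have hμ : hexConnectiveConstant ^ 4 < y := mu_four_lt_twelve_fv.trans_le (by linarith)
  -- split the series beyond half-length seven once more: `s = 8, 9, 10, 11` and `s ≥ 12`
  have h := (hasSum_nat_add_iff' 4).2 (hasSum_visitExcess_sixteen hμ)
  have hT := hasSum_excess_tail_twelve hμ
  have hTle := excess_tail_twelve_le hy
  have hle : ∀ j : ℕ, (IPWBV (2 * (j + 4 + 8)) y - IPWB (2 * (j + 4 + 8)) y) / wallRate y ^ (2 * (j + 4 + 8)) ≤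
      1 / 2 * (((j : ℝ) + 11) * pwbLaw y (j + 12)) := by
    intro j
    have h1 := IPWBV_sub_IPWB_le_mul (j + 4 + 8) hy0.le
    have hβ : 0 < wallRate y ^ (2 * (j + 4 + 8)) := pow_pos (wallRate_pos y) _
    rw [pwbLaw, show j + 12 = j + 4 + 8 by omega]
    calc (IPWBV (2 * (j + 4 + 8)) y - IPWB (2 * (j + 4 + 8)) y) / wallRate y ^ (2 * (j + 4 + 8))
        ≤ (((j + 4 + 8 : ℕ) : ℝ) - 1) / 2 * IPWB (2 * (j + 4 + 8)) y / wallRate y ^ (2 * (j + 4 + 8)) :=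
          div_le_div_of_nonneg_right h1 hβ.le
      _ = 1 / 2 * (((j : ℝ) + 11) * (IPWB (2 * (j + 4 + 8)) y / wallRate y ^ (2 * (j + 4 + 8)))) := by
          push_cast; ring
  have hsum := hasSum_le hle h (hT.mul_left (1 / 2))
  -- the four census terms
  have h8 := visitExcess_term_le_nine_pow (s := 8) (by norm_num) hy1
  have h9 := visitExcess_term_le_nine_pow (s := 9) (by norm_num) hy1
  have h10 := visitExcess_term_le_nine_pow (s := 10) (by norm_num) hy1
  have h11 := visitExcess_term_le_nine_pow (s := 11) (by norm_num) hy1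
  have hfour : ∑ i ∈ Finset.range 4, (IPWBV (2 * (i + 8)) y - IPWB (2 * (i + 8)) y) / wallRate y ^ (2 * (i + 8)) ≤
      136802479338 / y ^ 6 := by
    rw [Finset.sum_range_succ, Finset.sum_range_succ, Finset.sum_range_succ, Finset.sum_range_succ, Finset.sum_range_zero, zero_add,
      show 2 * (0 + 8) = 2 * 8 by norm_num, show 2 * (1 + 8) = 2 * 9 by norm_num, show 2 * (2 + 8) = 2 * 10 by norm_num,
      show 2 * (3 + 8) = 2 * 11 by norm_num]
    have e : (136802479338 : ℝ) / y ^ 6 = ((8 : ℕ) - 7 : ℝ) * 9 ^ 8 / y ^ 6 + ((9 : ℕ) - 7 : ℝ) * 9 ^ 9 / y ^ 6 +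
        ((10 : ℕ) - 7 : ℝ) * 9 ^ 10 / y ^ 6 + ((11 : ℕ) - 7 : ℝ) * 9 ^ 11 / y ^ 6 := by
      push_cast
      field_simp
      norm_num
    rw [e]
    linarith
  have hhalf : 1 / 2 * (pwbMean y - 1 - (2 * pwbLaw y 3 + 3 * pwbLaw y 4 + 4 * pwbLaw y 5 + 5 * pwbLaw y 6 + 6 * pwbLaw y 7 +
      7 * pwbLaw y 8 + 8 * pwbLaw y 9 + 9 * pwbLaw y 10 + 10 * pwbLaw y 11)) ≤ 12 * hexConnectiveConstant ^ 26 / (y ^ 5 * Real.sqrt y) := by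
    have e : 12 * hexConnectiveConstant ^ 26 / (y ^ 5 * Real.sqrt y) = 1 / 2 * (24 * hexConnectiveConstant ^ 26 / (y ^ 5 * Real.sqrt y)) := by
      ring
    rw [e]
    exact mul_le_mul_of_nonneg_left hTle (by norm_num)
  linarith

/-! ### §8 THE VISIT MEAN TO FIFTH ORDER: `y⁴(V − 1) → 1`, `y⁵(V − 1 − 1/y⁴) → 3` -/

/-- `y⁶/β(y)¹⁴ → 0` (`= (y⁷/β¹⁴)/y`). [cite: BeatonBousquetMelouDeGierDuminilCopinGuttmann2014, Section 3.1, Proposition 5 (arXiv v5 p. 9)] -/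
theorem tendsto_pow_six_div_wallRate_pow_fourteen : Tendsto (fun y : ℝ => y ^ 6 / wallRate y ^ 14) atTop (𝓝 0) := by
  have h := tendsto_pow_seven_div_wallRate_pow_fourteen.mul tendsto_inv_atTop_zero
  rw [mul_zero] at h
  refine h.congr' ?_
  filter_upwards [eventually_gt_atTop (0 : ℝ)] with y hy
  have hw : wallRate y ≠ 0 := (wallRate_pos y).ne'
  field_simp

/-- ★★★ **`y⁴ (V(y) − 1) → 1`** (`y → ∞`), `1 = N₆₂`: to fourth order the only renewal blocks visiting the surface twice are the hooked
twelves — «VISIT-EXCESS» had `y²(V − 1) → 0`, the coefficient of `y⁻³` is `N₅₂ = 0` («THIRD-EXACT»), and this is the next, nonzero one.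
[cite: MadrasSlade1993, Section 4.2, Theorem 4.2.2 (pp. 91–92)] [cite: Kesten1963SAW, Section 4] [cite: JansevanRensburgWhittington2013, Section 3.1] -/
theorem tendsto_pow_four_mul_pwbVisitMean_sub_one : Tendsto (fun y : ℝ => y ^ 4 * (pwbVisitMean y - 1)) atTop (𝓝 1) := by
  have hlow : Tendsto (fun y : ℝ => y ^ 6 / wallRate y ^ 12 + 3 * (y ^ 6 / wallRate y ^ 14)) atTop (𝓝 (1 + 3 * 0)) :=
    tendsto_pow_six_div_wallRate_pow_twelve.add (tendsto_pow_six_div_wallRate_pow_fourteen.const_mul 3)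
  rw [mul_zero, add_zero] at hlow
  have h1 : Tendsto (fun y : ℝ => (136802479338 : ℝ) / y ^ 2) atTop (𝓝 0) := tendsto_const_nhds.div_atTop (tendsto_pow_atTop two_ne_zero)
  have h2 : Tendsto (fun y : ℝ => 12 * hexConnectiveConstant ^ 26 / (y * Real.sqrt y)) atTop (𝓝 0) :=
    tendsto_const_nhds.div_atTop (tendsto_id.atTop_mul_atTop₀ Real.tendsto_sqrt_atTop)
  have hup : Tendsto (fun y : ℝ => y ^ 6 / wallRate y ^ 12 + 3 * (y ^ 6 / wallRate y ^ 14) + 136802479338 / y ^ 2 +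
      12 * hexConnectiveConstant ^ 26 / (y * Real.sqrt y)) atTop (𝓝 1) := by
    simpa using (hlow.add h1).add h2
  refine tendsto_of_tendsto_of_tendsto_of_le_of_le' hlow hup ?_ ?_
  · filter_upwards [eventually_gt_atTop (hexConnectiveConstant ^ 4)] with y hy
    have hy0 : 0 < y := lt_of_le_of_lt (by positivity) hy
    have h := mul_le_mul_of_nonneg_left (pwbVisitMean_sub_one_ge hy) (pow_pos hy0 4).le
    have e : y ^ 4 * (y ^ 2 / wallRate y ^ 12 + 3 * y ^ 2 / wallRate y ^ 14) = y ^ 6 / wallRate y ^ 12 + 3 * (y ^ 6 / wallRate y ^ 14) := by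
      ring
    rw [e] at h
    exact h
  · filter_upwards [eventually_ge_atTop (48 : ℝ)] with y hy
    have hy0 : 0 < y := by linarith
    have h := mul_le_mul_of_nonneg_left (pwbVisitMean_sub_one_le_five hy) (pow_pos hy0 4).le
    have e1 : y ^ 4 * (136802479338 / y ^ 6) = 136802479338 / y ^ 2 := by
      rw [mul_div_assoc', div_eq_div_iff (by positivity) (by positivity)]; ring
    have e2 : y ^ 4 * (12 * hexConnectiveConstant ^ 26 / (y ^ 5 * Real.sqrt y)) = 12 * hexConnectiveConstant ^ 26 / (y * Real.sqrt y) := by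
      have hs : 0 < Real.sqrt y := Real.sqrt_pos.2 hy0
      rw [mul_div_assoc', div_eq_div_iff (by positivity) (by positivity)]; ring
    calc y ^ 4 * (pwbVisitMean y - 1)
        ≤ y ^ 4 * (y ^ 2 / wallRate y ^ 12 + 3 * y ^ 2 / wallRate y ^ 14 + 136802479338 / y ^ 6 +
            12 * hexConnectiveConstant ^ 26 / (y ^ 5 * Real.sqrt y)) := h
      _ = y ^ 6 / wallRate y ^ 12 + 3 * (y ^ 6 / wallRate y ^ 14) + 136802479338 / y ^ 2 +
            12 * hexConnectiveConstant ^ 26 / (y * Real.sqrt y) := by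
          rw [mul_add, mul_add, mul_add, e1, e2]; ring

/-- ★★★ **`y⁵ (V(y) − 1 − y²/β(y)¹²) → 3`** (`y → ∞`), `3 = N₇₂`: the three hooked fourteens carry the fifth order of the visit excess.
[cite: MadrasSlade1993, Section 4.2, Theorem 4.2.2 (pp. 91–92)] [cite: Kesten1963SAW, Section 4] [cite: JansevanRensburgWhittington2013, Section 3.1] -/
theorem tendsto_pow_five_mul_pwbVisitMean_sub :
    Tendsto (fun y : ℝ => y ^ 5 * (pwbVisitMean y - 1 - y ^ 2 / wallRate y ^ 12)) atTop (𝓝 3) := by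
  have hlow : Tendsto (fun y : ℝ => 3 * (y ^ 7 / wallRate y ^ 14)) atTop (𝓝 3) := by
    simpa using tendsto_pow_seven_div_wallRate_pow_fourteen.const_mul 3
  have h1 : Tendsto (fun y : ℝ => (136802479338 : ℝ) / y) atTop (𝓝 0) := tendsto_const_nhds.div_atTop tendsto_id
  have h2 : Tendsto (fun y : ℝ => 12 * hexConnectiveConstant ^ 26 / Real.sqrt y) atTop (𝓝 0) :=
    tendsto_const_nhds.div_atTop Real.tendsto_sqrt_atTop
  have hup : Tendsto (fun y : ℝ => 3 * (y ^ 7 / wallRate y ^ 14) + 136802479338 / y + 12 * hexConnectiveConstant ^ 26 / Real.sqrt y)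
      atTop (𝓝 3) := by
    simpa using (hlow.add h1).add h2
  refine tendsto_of_tendsto_of_tendsto_of_le_of_le' hlow hup ?_ ?_
  · filter_upwards [eventually_gt_atTop (hexConnectiveConstant ^ 4)] with y hy
    have hy0 : 0 < y := lt_of_le_of_lt (by positivity) hy
    have h := pwbVisitMean_sub_one_ge hy
    have hle : 3 * y ^ 2 / wallRate y ^ 14 ≤ pwbVisitMean y - 1 - y ^ 2 / wallRate y ^ 12 := by linarith
    have hm := mul_le_mul_of_nonneg_left hle (pow_pos hy0 5).le
    have e : y ^ 5 * (3 * y ^ 2 / wallRate y ^ 14) = 3 * (y ^ 7 / wallRate y ^ 14) := by ring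
    rw [e] at hm
    exact hm
  · filter_upwards [eventually_ge_atTop (48 : ℝ)] with y hy
    have hy0 : 0 < y := by linarith
    have h := pwbVisitMean_sub_one_le_five hy
    have hle : pwbVisitMean y - 1 - y ^ 2 / wallRate y ^ 12 ≤ 3 * y ^ 2 / wallRate y ^ 14 + 136802479338 / y ^ 6 +
        12 * hexConnectiveConstant ^ 26 / (y ^ 5 * Real.sqrt y) := by linarith
    have hm := mul_le_mul_of_nonneg_left hle (pow_pos hy0 5).le
    have e1 : y ^ 5 * (3 * y ^ 2 / wallRate y ^ 14) = 3 * (y ^ 7 / wallRate y ^ 14) := by ring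
    have e2 : y ^ 5 * (136802479338 / y ^ 6) = 136802479338 / y := by
      rw [mul_div_assoc', div_eq_div_iff (by positivity) (by positivity)]; ring
    have e3 : y ^ 5 * (12 * hexConnectiveConstant ^ 26 / (y ^ 5 * Real.sqrt y)) = 12 * hexConnectiveConstant ^ 26 / Real.sqrt y := by
      have hs : 0 < Real.sqrt y := Real.sqrt_pos.2 hy0
      rw [mul_div_assoc', div_eq_div_iff (by positivity) (by positivity)]; ring
    calc y ^ 5 * (pwbVisitMean y - 1 - y ^ 2 / wallRate y ^ 12)
        ≤ y ^ 5 * (3 * y ^ 2 / wallRate y ^ 14 + 136802479338 / y ^ 6 + 12 * hexConnectiveConstant ^ 26 / (y ^ 5 * Real.sqrt y)) := hm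
      _ = 3 * (y ^ 7 / wallRate y ^ 14) + 136802479338 / y + 12 * hexConnectiveConstant ^ 26 / Real.sqrt y := by
          rw [mul_add, mul_add, e1, e2, e3]

/-- **The twelve term to fifth order**: `y⁵·(y²/β¹²) − y → 0` (`= y(r⁶ − 1) = −y(1 − r)(1 + r + ⋯ + r⁵)`, `r = y/β²`, `y(1 − r) → 0`).
[cite: BeatonBousquetMelouDeGierDuminilCopinGuttmann2014, Section 3.1, Proposition 5 (arXiv v5 p. 9)] -/
theorem tendsto_pow_five_mul_sq_div_sub : Tendsto (fun y : ℝ => y ^ 5 * (y ^ 2 / wallRate y ^ 12) - y) atTop (𝓝 0) := by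
  have hr := tendsto_div_wallRate_sq
  have hy1r : Tendsto (fun y : ℝ => y ^ 2 * (1 - y / wallRate y ^ 2) * y⁻¹) atTop (𝓝 0) := by
    simpa using tendsto_sq_mul_one_sub_div_wallRate_sq.mul tendsto_inv_atTop_zero
  have h := (hy1r.mul ((tendsto_const_nhds (x := (1 : ℝ))).add (hr.add ((hr.pow 2).add ((hr.pow 3).add ((hr.pow 4).add
    (hr.pow 5))))))).const_mul (-1)
  have e : (-1 : ℝ) * (0 * (1 + (1 + (1 ^ 2 + (1 ^ 3 + (1 ^ 4 + 1 ^ 5)))))) = 0 := by norm_num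
  rw [e] at h
  refine h.congr' ?_
  filter_upwards [eventually_gt_atTop (0 : ℝ)] with y hy
  have hw : wallRate y ≠ 0 := (wallRate_pos y).ne'
  have hy' : y ≠ 0 := hy.ne'
  field_simp
  ring

/-- ★★★ **`y⁵ (V(y) − 1 − 1/y⁴) → 3`**, i.e. **`V(y) = 1 + 1/y⁴ + 3/y⁵ + o(y⁻⁵)`** (`y → ∞`): the mean number of surface visits of a
renewal block in the strongly adsorbed phase. [cite: MadrasSlade1993, Section 4.2, Theorem 4.2.2 (pp. 91–92)] [cite: Kesten1963SAW, Section 4]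
[cite: JansevanRensburgWhittington2013, Section 3.1] -/
theorem tendsto_pow_five_mul_pwbVisitMean_sub_one_sub :
    Tendsto (fun y : ℝ => y ^ 5 * (pwbVisitMean y - 1 - 1 / y ^ 4)) atTop (𝓝 3) := by
  have h := tendsto_pow_five_mul_pwbVisitMean_sub.add tendsto_pow_five_mul_sq_div_sub
  rw [add_zero] at h
  refine h.congr' ?_
  filter_upwards [eventually_gt_atTop (0 : ℝ)] with y hy
  have hy' : y ≠ 0 := hy.ne'
  have e : y ^ 5 * (1 / y ^ 4) = y := by
    rw [mul_div_assoc', div_eq_iff (by positivity)]; ring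
  calc y ^ 5 * (pwbVisitMean y - 1 - y ^ 2 / wallRate y ^ 12) + (y ^ 5 * (y ^ 2 / wallRate y ^ 12) - y)
      = y ^ 5 * (pwbVisitMean y - 1) - y := by ring
    _ = y ^ 5 * (pwbVisitMean y - 1 - 1 / y ^ 4) := by
        rw [show y ^ 5 * (pwbVisitMean y - 1 - 1 / y ^ 4) = y ^ 5 * (pwbVisitMean y - 1) - y ^ 5 * (1 / y ^ 4) by ring, e]

/-- ★ **Asymptotic equivalence** `V(y) − 1 ∼ 1/y⁴`. [cite: MadrasSlade1993, Section 4.2, Theorem 4.2.2 (pp. 91–92)] [cite: JansevanRensburgWhittington2013, Section 3.1] -/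
theorem isEquivalent_pwbVisitMean_sub_one : (fun y : ℝ => pwbVisitMean y - 1) ~[atTop] fun y : ℝ => 1 / y ^ 4 := by
  have hz : ∀ᶠ y : ℝ in atTop, (1 : ℝ) / y ^ 4 ≠ 0 := by
    filter_upwards [eventually_gt_atTop (0 : ℝ)] with y hy
    positivity
  refine (isEquivalent_iff_tendsto_one hz).2 ?_
  refine tendsto_pow_four_mul_pwbVisitMean_sub_one.congr' ?_
  filter_upwards [eventually_gt_atTop (0 : ℝ)] with y hy
  simp only [Pi.div_apply]
  field_simp

/-! ### §9 THE CONTACT DENSITY TO FIFTH ORDER: `½ − ρ(log y) = 1/y² + 3/(2y³) + 3/y⁴ + 15/(2y⁵) + o(y⁻⁵)` -/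

/-- ★★★ **`y⁴ (½ − ρ⁺(log y) − 1/y² − 3/(2y³)) → 3`** (`y → ∞`): the FOURTH coefficient of the strong-adsorption expansion of the surface
contact density — by the renewal–reward identity `½ − ρ⁺ = (m − V)/(2m)` («NO-KINK»/«VISIT-EXCESS») and
`y⁴(m − 1 − 2/y² − 3/y³) → 11`, `y⁴(V − 1) → 1`, `y²(m − 1) → 2`: `3 = (11 − 1 − 2·2)/2`.
[cite: Giacomin2011, Chapter 2, eq. (2.11)] [cite: BeatonBousquetMelouDeGierDuminilCopinGuttmann2014, Section 3.1, Proposition 5 (arXiv v5 p. 9) and p. 10]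
[cite: JansevanRensburgWhittington2013, Section 3.1] [cite: MadrasSlade1993, Section 4.2, Theorem 4.2.2 (pp. 91–92)] -/
theorem tendsto_pow_four_mul_density_deficit :
    Tendsto (fun y : ℝ => y ^ 4 * (1 / 2 - wallRightDensity (Real.log y) - 1 / y ^ 2 - 3 / (2 * y ^ 3))) atTop (𝓝 3) := by
  have hA := tendsto_pow_four_mul_pwbMean_sub_one_sub_sub
  have hB := tendsto_pow_four_mul_pwbVisitMean_sub_one
  have hD := tendsto_sq_mul_pwbMean_sub_one
  have hE := tendsto_mul_pwbMean_sub_one_df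
  have hm := tendsto_pwbMean_df
  have h := (((hA.sub hB).sub (hD.const_mul 2)).sub (hE.const_mul 3)).div (hm.const_mul 2) (by norm_num)
  have e : ((11 : ℝ) - 1 - 2 * 2 - 3 * 0) / (2 * 1) = 3 := by norm_num
  rw [e] at h
  refine h.congr' ?_
  filter_upwards [eventually_gt_atTop (hexConnectiveConstant ^ 4)] with y hy
  have hy0 : 0 < y := lt_of_le_of_lt (by positivity) hy
  have hm0 : pwbMean y ≠ 0 := (pwbMean_pos hy).ne'
  have hid := pwbMean_sub_pwbVisitMean_eq hy
  -- `m − V = 2m·(½ − ρ⁺)`; clear denominators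
  have hy' : y ≠ 0 := hy0.ne'
  simp only [Pi.div_apply]
  rw [div_eq_iff (mul_ne_zero two_ne_zero hm0)]
  have e2 : y ^ 4 * (1 / 2 - wallRightDensity (Real.log y) - 1 / y ^ 2 - 3 / (2 * y ^ 3)) * (2 * pwbMean y) =
      y ^ 4 * (2 * pwbMean y * (1 / 2 - wallRightDensity (Real.log y))) - 2 * pwbMean y * y ^ 2 - 3 * pwbMean y * y := by
    field_simp
  rw [e2, ← hid]
  field_simp
  ring

/-- ★★★ **`y⁵ (½ − ρ⁺(log y) − 1/y² − 3/(2y³) − 3/y⁴) → 15/2`** (`y → ∞`): the FIFTH coefficient —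
`15/2 = (30 − 3 − 2·3 − 3·2)/2` from `y⁵(m − 1 − 2/y² − 3/y³ − 11/y⁴) → 30`, `y⁵(V − 1 − 1/y⁴) → 3`, `y³(m − 1 − 2/y²) → 3`, `y²(m − 1) → 2`.
Hence **`½ − ρ(log y) = 1/y² + 3/(2y³) + 3/y⁴ + 15/(2y⁵) + o(y⁻⁵)`**.
[cite: Giacomin2011, Chapter 2, eq. (2.11)] [cite: BeatonBousquetMelouDeGierDuminilCopinGuttmann2014, Section 3.1, Proposition 5 (arXiv v5 p. 9) and p. 10]
[cite: JansevanRensburgWhittington2013, Section 3.1] [cite: MadrasSlade1993, Section 4.2, Theorem 4.2.2 (pp. 91–92)] -/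
theorem tendsto_pow_five_mul_density_deficit :
    Tendsto (fun y : ℝ => y ^ 5 * (1 / 2 - wallRightDensity (Real.log y) - 1 / y ^ 2 - 3 / (2 * y ^ 3) - 3 / y ^ 4)) atTop
      (𝓝 (15 / 2)) := by
  have hA := tendsto_pow_five_mul_pwbMean_sub_four_terms
  have hB := tendsto_pow_five_mul_pwbVisitMean_sub_one_sub
  have hC := tendsto_cube_mul_pwbMean_sub_one_sub_two_div_sq
  have hD := tendsto_sq_mul_pwbMean_sub_one
  have hE := tendsto_mul_pwbMean_sub_one_df
  have hm := tendsto_pwbMean_df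
  have h := ((((hA.sub hB).sub (hC.const_mul 2)).sub (hD.const_mul 3)).sub (hE.const_mul 6)).div (hm.const_mul 2) (by norm_num)
  have e : ((30 : ℝ) - 3 - 2 * 3 - 3 * 2 - 6 * 0) / (2 * 1) = 15 / 2 := by norm_num
  rw [e] at h
  refine h.congr' ?_
  filter_upwards [eventually_gt_atTop (hexConnectiveConstant ^ 4)] with y hy
  have hy0 : 0 < y := lt_of_le_of_lt (by positivity) hy
  have hm0 : pwbMean y ≠ 0 := (pwbMean_pos hy).ne'
  have hid := pwbMean_sub_pwbVisitMean_eq hy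
  have hy' : y ≠ 0 := hy0.ne'
  simp only [Pi.div_apply]
  rw [div_eq_iff (mul_ne_zero two_ne_zero hm0)]
  have e2 : y ^ 5 * (1 / 2 - wallRightDensity (Real.log y) - 1 / y ^ 2 - 3 / (2 * y ^ 3) - 3 / y ^ 4) * (2 * pwbMean y) =
      y ^ 5 * (2 * pwbMean y * (1 / 2 - wallRightDensity (Real.log y))) - 2 * pwbMean y * y ^ 3 - 3 * pwbMean y * y ^ 2 -
        6 * pwbMean y * y := by
    field_simp
    ring
  rw [e2, ← hid]
  field_simp
  ring

/-- ★★ **The same for the left density** (no kink on the regime `eᵗ > μ⁴`): `y⁴ (½ − ρ⁻(log y) − 1/y² − 3/(2y³)) → 3`.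
[cite: Giacomin2011, Chapter 2, eq. (2.11)] [cite: JansevanRensburgWhittington2013, Section 3.1, eq. (3.4)] -/
theorem tendsto_pow_four_mul_density_deficit_left :
    Tendsto (fun y : ℝ => y ^ 4 * (1 / 2 - wallLeftDensity (Real.log y) - 1 / y ^ 2 - 3 / (2 * y ^ 3))) atTop (𝓝 3) := by
  refine tendsto_pow_four_mul_density_deficit.congr' ?_
  filter_upwards [eventually_gt_atTop (hexConnectiveConstant ^ 4)] with y hy
  have hy0 : 0 < y := lt_of_le_of_lt (by positivity) hy
  have ht : hexConnectiveConstant ^ 4 < Real.exp (Real.log y) := by rwa [Real.exp_log hy0]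
  rw [wallLeftDensity_eq_wallRightDensity ht]

/-- ★★ **… and to fifth order**: `y⁵ (½ − ρ⁻(log y) − 1/y² − 3/(2y³) − 3/y⁴) → 15/2`.
[cite: Giacomin2011, Chapter 2, eq. (2.11)] [cite: JansevanRensburgWhittington2013, Section 3.1, eq. (3.4)] -/
theorem tendsto_pow_five_mul_density_deficit_left :
    Tendsto (fun y : ℝ => y ^ 5 * (1 / 2 - wallLeftDensity (Real.log y) - 1 / y ^ 2 - 3 / (2 * y ^ 3) - 3 / y ^ 4)) atTop
      (𝓝 (15 / 2)) := by
  refine tendsto_pow_five_mul_density_deficit.congr' ?_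
  filter_upwards [eventually_gt_atTop (hexConnectiveConstant ^ 4)] with y hy
  have hy0 : 0 < y := lt_of_le_of_lt (by positivity) hy
  have ht : hexConnectiveConstant ^ 4 < Real.exp (Real.log y) := by rwa [Real.exp_log hy0]
  rw [wallLeftDensity_eq_wallRightDensity ht]

/-- ★★ **`t`-form, fourth order**: `e^{4t} (½ − ρ⁺(t) − e^{−2t} − (3/2)e^{−3t}) → 3` (`t → ∞`) — the continuation of the tree's
`e^{2t}(½ − ρ⁺(t)) → 1` and `e^{3t}(½ − ρ⁺(t) − e^{−2t}) → 3/2`. [cite: BeatonBousquetMelouDeGierDuminilCopinGuttmann2014, Section 3.1, Proposition 5 (arXiv v5 p. 9) and p. 10]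
[cite: Giacomin2011, Chapter 2, eq. (2.11)] [cite: JansevanRensburgWhittington2013, Section 3.1] -/
theorem tendsto_exp_four_mul_deficit :
    Tendsto (fun t : ℝ => Real.exp (4 * t) * (1 / 2 - wallRightDensity t - Real.exp (-(2 * t)) - 3 / 2 * Real.exp (-(3 * t)))) atTop
      (𝓝 3) := by
  have h := tendsto_pow_four_mul_density_deficit.comp Real.tendsto_exp_atTop
  refine h.congr' ?_
  filter_upwards [eventually_gt_atTop (0 : ℝ)] with t ht
  simp only [Function.comp_def, Real.log_exp]
  have e4 : Real.exp t ^ 4 = Real.exp (4 * t) := by rw [← Real.exp_nat_mul]; norm_num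
  have e2 : (1 : ℝ) / Real.exp t ^ 2 = Real.exp (-(2 * t)) := by
    rw [Real.exp_neg, ← Real.exp_nat_mul, one_div]; norm_num
  have e3 : (3 : ℝ) / (2 * Real.exp t ^ 3) = 3 / 2 * Real.exp (-(3 * t)) := by
    rw [Real.exp_neg, ← Real.exp_nat_mul]; push_cast; field_simp
  rw [e4, e2, e3]

/-- ★★ **`t`-form, fifth order**: `e^{5t} (½ − ρ⁺(t) − e^{−2t} − (3/2)e^{−3t} − 3e^{−4t}) → 15/2` (`t → ∞`).
[cite: BeatonBousquetMelouDeGierDuminilCopinGuttmann2014, Section 3.1, Proposition 5 (arXiv v5 p. 9) and p. 10] [cite: Giacomin2011, Chapter 2, eq. (2.11)]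
[cite: JansevanRensburgWhittington2013, Section 3.1] -/
theorem tendsto_exp_five_mul_deficit :
    Tendsto (fun t : ℝ => Real.exp (5 * t) *
      (1 / 2 - wallRightDensity t - Real.exp (-(2 * t)) - 3 / 2 * Real.exp (-(3 * t)) - 3 * Real.exp (-(4 * t)))) atTop (𝓝 (15 / 2)) := by
  have h := tendsto_pow_five_mul_density_deficit.comp Real.tendsto_exp_atTop
  refine h.congr' ?_
  filter_upwards [eventually_gt_atTop (0 : ℝ)] with t ht
  simp only [Function.comp_def, Real.log_exp]
  have e5 : Real.exp t ^ 5 = Real.exp (5 * t) := by rw [← Real.exp_nat_mul]; norm_num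
  have e2 : (1 : ℝ) / Real.exp t ^ 2 = Real.exp (-(2 * t)) := by
    rw [Real.exp_neg, ← Real.exp_nat_mul, one_div]; norm_num
  have e3 : (3 : ℝ) / (2 * Real.exp t ^ 3) = 3 / 2 * Real.exp (-(3 * t)) := by
    rw [Real.exp_neg, ← Real.exp_nat_mul]; push_cast; field_simp
  have e4 : (3 : ℝ) / Real.exp t ^ 4 = 3 * Real.exp (-(4 * t)) := by
    rw [Real.exp_neg, ← Real.exp_nat_mul]; push_cast; field_simp
  rw [e5, e2, e3, e4]

/-- ★★ **The logarithmic derivative of the growth rate to fifth order**: `y⁵ (½ − y β'(y)/β(y) − 1/y² − 3/(2y³) − 3/y⁴) → 15/2`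
(`y β'/β = V/(2m) = ρ⁺(log y)` on `y > μ⁴`, «NO-KINK»), i.e. `y β'(y)/β(y) = ½ − 1/y² − 3/(2y³) − 3/y⁴ − 15/(2y⁵) + o(y⁻⁵)`.
[cite: Giacomin2011, Chapter 2, eq. (2.11)] [cite: BeatonBousquetMelouDeGierDuminilCopinGuttmann2014, Section 3.1, Proposition 5 (arXiv v5 p. 9)]
[cite: JansevanRensburgWhittington2013, Section 3.1, eq. (3.3)] -/
theorem tendsto_pow_five_mul_logDeriv_wallRate_deficit :
    Tendsto (fun y : ℝ => y ^ 5 * (1 / 2 - y * deriv wallRate y / wallRate y - 1 / y ^ 2 - 3 / (2 * y ^ 3) - 3 / y ^ 4)) atTop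
      (𝓝 (15 / 2)) := by
  refine tendsto_pow_five_mul_density_deficit.congr' ?_
  filter_upwards [eventually_gt_atTop (hexConnectiveConstant ^ 4)] with y hy
  have hy0 : 0 < y := lt_of_le_of_lt (by positivity) hy
  have ht : hexConnectiveConstant ^ 4 < Real.exp (Real.log y) := by rwa [Real.exp_log hy0]
  have h1 := wallRightDensity_eq_visitMean_div ht
  rw [Real.exp_log hy0] at h1
  rw [mul_deriv_wallRate_div_eq hy, ← h1]

/-- ★ **Asymptotic equivalence of the fourth-order remainder**: `½ − ρ⁺(log y) − 1/y² − 3/(2y³) ∼ 3/y⁴`.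
[cite: Giacomin2011, Chapter 2, eq. (2.11)] [cite: JansevanRensburgWhittington2013, Section 3.1] -/
theorem isEquivalent_density_deficit_fourth :
    (fun y : ℝ => 1 / 2 - wallRightDensity (Real.log y) - 1 / y ^ 2 - 3 / (2 * y ^ 3)) ~[atTop] fun y : ℝ => 3 / y ^ 4 := by
  have hz : ∀ᶠ y : ℝ in atTop, (3 : ℝ) / y ^ 4 ≠ 0 := by
    filter_upwards [eventually_gt_atTop (0 : ℝ)] with y hy
    positivity
  refine (isEquivalent_iff_tendsto_one hz).2 ?_
  have h := tendsto_pow_four_mul_density_deficit.div_const 3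
  rw [show ((3 : ℝ) / 3) = 1 by norm_num] at h
  refine h.congr' ?_
  filter_upwards [eventually_gt_atTop (0 : ℝ)] with y hy
  simp only [Pi.div_apply]
  rw [div_div_eq_mul_div]
  ring

end Literature.Probability.RandomPlanarGeometry.SAW.HexBW.Wall
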